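import Summits.ValiantsHypothesis.ValiantsHypothesis.Theorems.KPlusLogSqLawTropicalCensusRows
import Summits.ValiantsHypothesis.ValiantsHypothesis.Theorems.KPlusLogSqLawTridiagonalRealStaticEightTen
import Summits.ValiantsHypothesis.ValiantsHypothesis.Theorems.KPlusLogSqLawTropicalBSplitDefs

/-!
# Route «KPlusLogSqLaw», crux `WeakLifting` (stmt-ValiantsHypothesis-19561) — REAL vs TROPICAL side of the tridiagonal sector:
# THE FIRST LADDER RUNG IS TROPICALLY FLAT — the `8 × 8` boost-plus-rungs design has signed tropical count EXACTLY `2` against `10` real zeros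

HONEST FRAMING.  Helper theorems (`--supports stmt-ValiantsHypothesis-19561 --as helper`), seat val-sym-lift-p1 (g14), cell
`pub-symmetroid`, 2026-08-28; third kernel row of the «tropical shadow» table after `…TridiagonalRealStaticPumpShadow` (p596186: pump,
`0` alternations vs `14` zeros) and `…TridiagonalRealStaticBoostShadow` (p598473: `12 × 12` ladder, `2` vs `16`).  Here the `8 × 8` design of
`…TridiagonalRealStaticEightTen` (val-sym-lift-p1 g11, p563540: the `m = 5` boost block with one fast decreasing edge on the left and two fast
increasing rungs on the right, `10 = m + 2` positive zeros) is read against its base-2 tropical shadow: signed census row EXACTLY `2`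
(attained), real count `≥ 10`.  One explicit design with exact LP-dual certificates; nothing here is an upper bound, and nothing bears on
`WeakLifting` / `TropicalB` (stmt-19771) in their windows, on Conjecture B, on the Door-A registers, on `MatrixDescartes` (stmt-18050) or on
VP ≠ VNP; the FORMAT-level lifting statements of the crux are untouched (design-level structure only).

THE DESIGN.  Classes `d = (0, 1, 5, 6, 40, 59)` (the six distinct exponents of the EightTen matrix: diagonal `(2¹²⁰X⁵⁹, X, 4, X, 1, 1, 2, 2)`,
links `(1, 2, X, 2X, X⁵, 8X⁶, 64X⁴⁰)`), `ε = 1` on the one class of each band entry, `v = −log₂(coefficient)`.  Relative to the empty matching a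
matching `μ` weighs `∑_{k ∈ μ} (A_k + L_k θ)` with `A = (−120, 0, −2, 2, 0, 5, 10)`, `L = (−60, −1, 1, 1, 10, 12, 80)`.  Over INTEGER slopes the
unique optimum is the link `{0}` (sign `−`) for `θ ≤ −3`, `{1,3}` (sign `+`) at `θ = −1`, `{4,6}` (sign `+`) at `θ = 1` and `{2,4,6}` (sign `−`)
for `θ ≥ 3`, while `θ = −2, 0, 2` are exact ties (`{1} ~ {1,3}` at `4`, `{1,3,6} ~ {3,6}` at `136`, `{4,6} ~ {2,4,6}` at `436`, absolute weights)
with NO dominant term.  So the dominant sign along the integers reads `−, +, +, −`: every sign-alternating dominant chain has `n ≤ 2` (a fourth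
term would need a dominant term at slope `0`), and the chain `{0} @ −3`, `{1,3} @ −1`, `{2,4,6} @ 3` attains `n = 2`.

WHAT IS PROVED (no definitions; data inline; certificates by `decide`; the generic LP-duality / transport / tie steps of `…PumpShadow`
(p596186) are restated inside the proof as local `have`s, so that this file does not depend on that module's build).
**`boost8_shadow`**: `|ε| ≤ 1`; symmetric patchwork letters; CLASSIFICATION of the dominant terms at every integer slope (strict scaled
potentials at `θ = −3, −1, 1, 3`, transport to the half-lines by the extremal total exponents `1` and `152`, tie certificates at `−2, 0, 2`);
every dominant term has `termSign = 1` at `θ = ±1` and `−1` elsewhere; **every sign-alternating chain of dominant terms along strictly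
increasing integer slopes has `n ≤ 2`, and one with `n = 2` exists**; the base-2 patchwork pencil IS the EightTen matrix (entry by entry),
hence (p563540) has `≥ 10` distinct positive determinant zeros.  `boost8_shadow_exists` repackages it.
[data: val-sym-lift-p1 g11's design (p563540); tropical reading and certificates (session tools/cert/eight10.py): this seat;
folklore: LP duality / parametric assignment, Viro patchworking.]
-/
-- `Summit.ValiantsHypothesis.ValiantsHypothesis.…` repeats a component by the D-0017 layout (single-conjunct summit); the name is mandated.
set_option linter.dupNamespace false
set_option autoImplicit false

namespace Summit.ValiantsHypothesis.ValiantsHypothesis.Theorems.KPlusLogSqLaw.StaticTridiagonalRealBoostEightShadow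

open Summit.ValiantsHypothesis.ValiantsHypothesis.Theorems.MatrixDescartes.Negative
open Summit.ValiantsHypothesis.ValiantsHypothesis.Theorems.LacunarySymmetroidMatrixDescartes.TropicalCensus
open Summit.ValiantsHypothesis.ValiantsHypothesis.Theorems.ValuativeFlip (ctPath ctPath_apply)
open Finset Polynomial
open scoped BigOperators

set_option maxHeartbeats 4000000 in
set_option exponentiation.threshold 20000 in
/-- **THE FIRST LADDER RUNG IS TROPICALLY FLAT.**  For the explicit dominance design `(d, v, ε)` of format `(8, 6)` written in the
statement (the base-2 shadow of the EightTen design): `|ε| ≤ 1`; the patchwork letters are symmetric; a term is dominant at the integer slope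
`θ` iff (`θ ≤ −3` and it is the link `{0}`) or (`θ = −1`, matching `{1,3}`) or (`θ = 1`, `{4,6}`) or (`θ ≥ 3`, `{2,4,6}`); hence a dominant term
has `termSign = 1` iff `θ = ±1` and `−1` otherwise; every sign-alternating dominant chain at strictly increasing integer slopes has `n ≤ 2`
and one with `n = 2` exists; the base-2 patchwork pencil equals the EightTen path matrix; and its determinant has at least `10` distinct
positive roots. [certificates of this seat (`decide`); real side = p563540] -/
theorem boost8_shadow :
    (∀ i j l, ((fun (a b : Fin 8) (l : Fin 6) => (if (((b : ℕ) = a ∨ (b : ℕ) = a + 1 ∨ (a : ℕ) = b + 1) ∧ l = (fun a b : Fin 8 => (if (b : ℕ) = a then (![5, 1, 0, 1, 0, 0, 0, 0] : Fin 8 → Fin 6) a else if (b : ℕ) = a + 1 then (![0, 0, 1, 1, 2, 3, 4, 0] : Fin 8 → Fin 6) a else if (a : ℕ) = b + 1 then (![0, 0, 1, 1, 2, 3, 4, 0] : Fin 8 → Fin 6) b else 0)) a b) then (1 : ℤ) else 0)) i j l).natAbs ≤ 1) ∧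
    (∀ l, (patchMatrix 2 (fun (a b : Fin 8) (_ : Fin 6) => -((fun a b : Fin 8 => (if (b : ℕ) = a then (![120, 0, 2, 0, 0, 0, 1, 1] : Fin 8 → ℤ) a else if (b : ℕ) = a + 1 then (![0, 1, 0, 1, 0, 3, 6, 0] : Fin 8 → ℤ) a else if (a : ℕ) = b + 1 then (![0, 1, 0, 1, 0, 3, 6, 0] : Fin 8 → ℤ) b else 0)) a b)) (fun (a b : Fin 8) (l : Fin 6) => (if (((b : ℕ) = a ∨ (b : ℕ) = a + 1 ∨ (a : ℕ) = b + 1) ∧ l = (fun a b : Fin 8 => (if (b : ℕ) = a then (![5, 1, 0, 1, 0, 0, 0, 0] : Fin 8 → Fin 6) a else if (b : ℕ) = a + 1 then (![0, 0, 1, 1, 2, 3, 4, 0] : Fin 8 → Fin 6) a else if (a : ℕ) = b + 1 then (![0, 0, 1, 1, 2, 3, 4, 0] : Fin 8 → Fin 6) b else 0)) a b) then (1 : ℤ) else 0)) l).IsSymm) ∧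
    (∀ (θ : ℤ) (p : Equiv.Perm (Fin 8) × (Fin 8 → Fin 6)), IsDominant (![0, 1, 5, 6, 40, 59] : Fin 6 → ℕ) (fun (a b : Fin 8) (_ : Fin 6) => -((fun a b : Fin 8 => (if (b : ℕ) = a then (![120, 0, 2, 0, 0, 0, 1, 1] : Fin 8 → ℤ) a else if (b : ℕ) = a + 1 then (![0, 1, 0, 1, 0, 3, 6, 0] : Fin 8 → ℤ) a else if (a : ℕ) = b + 1 then (![0, 1, 0, 1, 0, 3, 6, 0] : Fin 8 → ℤ) b else 0)) a b)) (fun (a b : Fin 8) (l : Fin 6) => (if (((b : ℕ) = a ∨ (b : ℕ) = a + 1 ∨ (a : ℕ) = b + 1) ∧ l = (fun a b : Fin 8 => (if (b : ℕ) = a then (![5, 1, 0, 1, 0, 0, 0, 0] : Fin 8 → Fin 6) a else if (b : ℕ) = a + 1 then (![0, 0, 1, 1, 2, 3, 4, 0] : Fin 8 → Fin 6) a else if (a : ℕ) = b + 1 then (![0, 0, 1, 1, 2, 3, 4, 0] : Fin 8 → Fin 6) b else 0)) a b) then (1 : ℤ) else 0)) θ p ↔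
      (θ ≤ -3 ∧ p = (((Equiv.swap (0 : Fin 8) 1 : Equiv.Perm (Fin 8)), fun i => (fun a b : Fin 8 => (if (b : ℕ) = a then (![5, 1, 0, 1, 0, 0, 0, 0] : Fin 8 → Fin 6) a else if (b : ℕ) = a + 1 then (![0, 0, 1, 1, 2, 3, 4, 0] : Fin 8 → Fin 6) a else if (a : ℕ) = b + 1 then (![0, 0, 1, 1, 2, 3, 4, 0] : Fin 8 → Fin 6) b else 0)) ((Equiv.swap (0 : Fin 8) 1 : Equiv.Perm (Fin 8)) i) i) : Equiv.Perm (Fin 8) × (Fin 8 → Fin 6))) ∨ (θ = -1 ∧ p = (((Equiv.swap (1 : Fin 8) 2 * Equiv.swap (3 : Fin 8) 4 : Equiv.Perm (Fin 8)), fun i => (fun a b : Fin 8 => (if (b : ℕ) = a then (![5, 1, 0, 1, 0, 0, 0, 0] : Fin 8 → Fin 6) a else if (b : ℕ) = a + 1 then (![0, 0, 1, 1, 2, 3, 4, 0] : Fin 8 → Fin 6) a else if (a : ℕ) = b + 1 then (![0, 0, 1, 1, 2, 3, 4, 0] : Fin 8 → Fin 6) b else 0)) ((Equiv.swap (1 :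 Fin 8) 2 * Equiv.swap (3 : Fin 8) 4 : Equiv.Perm (Fin 8)) i) i) : Equiv.Perm (Fin 8) × (Fin 8 → Fin 6))) ∨ (θ = 1 ∧ p = (((Equiv.swap (4 : Fin 8) 5 * Equiv.swap (6 : Fin 8) 7 : Equiv.Perm (Fin 8)), fun i => (fun a b : Fin 8 => (if (b : ℕ) = a then (![5, 1, 0, 1, 0, 0, 0, 0] : Fin 8 → Fin 6) a else if (b : ℕ) = a + 1 then (![0, 0, 1, 1, 2, 3, 4, 0] : Fin 8 → Fin 6) a else if (a : ℕ) = b + 1 then (![0, 0, 1, 1, 2, 3, 4, 0] : Fin 8 → Fin 6) b else 0)) ((Equiv.swap (4 : Fin 8) 5 * Equiv.swap (6 : Fin 8) 7 : Equiv.Perm (Fin 8)) i) i) : Equiv.Perm (Fin 8) × (Fin 8 → Fin 6))) ∨ (3 ≤ θ ∧ p = (((Equiv.swap (2 : Fin 8) 3 * Equiv.swap (4 : Fin 8) 5 * Equiv.swap (6 : Fin 8) 7 : Equiv.Perm (Fin 8)), fun i => (fun a b : Fin 8 => (if (b : ℕ) = a then (![5, 1, 0, 1, 0, 0, 0, 0]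 : Fin 8 → Fin 6) a else if (b : ℕ) = a + 1 then (![0, 0, 1, 1, 2, 3, 4, 0] : Fin 8 → Fin 6) a else if (a : ℕ) = b + 1 then (![0, 0, 1, 1, 2, 3, 4, 0] : Fin 8 → Fin 6) b else 0)) ((Equiv.swap (2 : Fin 8) 3 * Equiv.swap (4 : Fin 8) 5 * Equiv.swap (6 : Fin 8) 7 : Equiv.Perm (Fin 8)) i) i) : Equiv.Perm (Fin 8) × (Fin 8 → Fin 6)))) ∧
    (∀ (θ : ℤ) (p : Equiv.Perm (Fin 8) × (Fin 8 → Fin 6)), IsDominant (![0, 1, 5, 6, 40, 59] : Fin 6 → ℕ) (fun (a b : Fin 8) (_ : Fin 6) => -((fun a b : Fin 8 => (if (b : ℕ) = a then (![120, 0, 2, 0, 0, 0, 1, 1] : Fin 8 → ℤ) a else if (b : ℕ) = a + 1 then (![0, 1, 0, 1, 0, 3, 6, 0] : Fin 8 → ℤ) a else if (a : ℕ) = b + 1 then (![0, 1, 0, 1, 0, 3, 6, 0] : Fin 8 → ℤ) b else 0)) a b)) (fun (a b : Fin 8) (l : Fin 6) => (if (((b : ℕ) = a ∨ (b : ℕ)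 = a + 1 ∨ (a : ℕ) = b + 1) ∧ l = (fun a b : Fin 8 => (if (b : ℕ) = a then (![5, 1, 0, 1, 0, 0, 0, 0] : Fin 8 → Fin 6) a else if (b : ℕ) = a + 1 then (![0, 0, 1, 1, 2, 3, 4, 0] : Fin 8 → Fin 6) a else if (a : ℕ) = b + 1 then (![0, 0, 1, 1, 2, 3, 4, 0] : Fin 8 → Fin 6) b else 0)) a b) then (1 : ℤ) else 0)) θ p → termSign (fun (a b : Fin 8) (l : Fin 6) => (if (((b : ℕ) = a ∨ (b : ℕ) = a + 1 ∨ (a : ℕ) = b + 1) ∧ l = (fun a b : Fin 8 => (if (b : ℕ) = a then (![5, 1, 0, 1, 0, 0, 0, 0] : Fin 8 → Fin 6) a else if (b : ℕ) = a + 1 then (![0, 0, 1, 1, 2, 3, 4, 0] : Fin 8 → Fin 6) a else if (a : ℕ) = b + 1 then (![0, 0, 1, 1, 2, 3, 4, 0] : Fin 8 → Fin 6) b else 0)) a b) then (1 : ℤ) else 0)) p = if (θ = -1 ∨ θ = 1) then 1 else -1) ∧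
    (∀ (n : ℕ) (θ : Fin (n + 1) → ℤ) (p : Fin (n + 1) → Equiv.Perm (Fin 8) × (Fin 8 → Fin 6)), StrictMono θ →
      (∀ k, IsDominant (![0, 1, 5, 6, 40, 59] : Fin 6 → ℕ) (fun (a b : Fin 8) (_ : Fin 6) => -((fun a b : Fin 8 => (if (b : ℕ) = a then (![120, 0, 2, 0, 0, 0, 1, 1] : Fin 8 → ℤ) a else if (b : ℕ) = a + 1 then (![0, 1, 0, 1, 0, 3, 6, 0] : Fin 8 → ℤ) a else if (a : ℕ) = b + 1 then (![0, 1, 0, 1, 0, 3, 6, 0] : Fin 8 → ℤ) b else 0)) a b)) (fun (a b : Fin 8) (l : Fin 6) => (if (((b : ℕ) = a ∨ (b : ℕ) = a + 1 ∨ (a : ℕ) = b + 1) ∧ l = (fun a b : Fin 8 => (if (b : ℕ) = a then (![5, 1, 0, 1, 0, 0, 0, 0] : Fin 8 → Fin 6) a else if (b : ℕ) = a + 1 then (![0, 0, 1, 1, 2, 3, 4, 0] : Fin 8 → Fin 6) a else if (a : ℕ) = b + 1 then (![0, 0, 1, 1, 2, 3, 4, 0] : Fin 8 → Fin 6) b else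 0)) a b) then (1 : ℤ) else 0)) (θ k) (p k)) →
      (∀ k : Fin n, termSign (fun (a b : Fin 8) (l : Fin 6) => (if (((b : ℕ) = a ∨ (b : ℕ) = a + 1 ∨ (a : ℕ) = b + 1) ∧ l = (fun a b : Fin 8 => (if (b : ℕ) = a then (![5, 1, 0, 1, 0, 0, 0, 0] : Fin 8 → Fin 6) a else if (b : ℕ) = a + 1 then (![0, 0, 1, 1, 2, 3, 4, 0] : Fin 8 → Fin 6) a else if (a : ℕ) = b + 1 then (![0, 0, 1, 1, 2, 3, 4, 0] : Fin 8 → Fin 6) b else 0)) a b) then (1 : ℤ) else 0)) (p k.castSucc) * termSign (fun (a b : Fin 8) (l : Fin 6) => (if (((b : ℕ) = a ∨ (b : ℕ) = a + 1 ∨ (a : ℕ) = b + 1) ∧ l = (fun a b : Fin 8 => (if (b : ℕ) = a then (![5, 1, 0, 1, 0, 0, 0, 0] : Fin 8 → Fin 6) a else if (b : ℕ) = a + 1 then (![0, 0, 1, 1, 2, 3, 4, 0] : Fin 8 → Fin 6) a else if (a : ℕ) = b + 1 then (![0, 0, 1, 1, 2, 3, 4, 0] : Fin 8 → Fin 6)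 b else 0)) a b) then (1 : ℤ) else 0)) (p k.succ) < 0) → n ≤ 2) ∧
    (∃ (θ : Fin 3 → ℤ) (p : Fin 3 → Equiv.Perm (Fin 8) × (Fin 8 → Fin 6)), StrictMono θ ∧ (∀ k, IsDominant (![0, 1, 5, 6, 40, 59] : Fin 6 → ℕ) (fun (a b : Fin 8) (_ : Fin 6) => -((fun a b : Fin 8 => (if (b : ℕ) = a then (![120, 0, 2, 0, 0, 0, 1, 1] : Fin 8 → ℤ) a else if (b : ℕ) = a + 1 then (![0, 1, 0, 1, 0, 3, 6, 0] : Fin 8 → ℤ) a else if (a : ℕ) = b + 1 then (![0, 1, 0, 1, 0, 3, 6, 0] : Fin 8 → ℤ) b else 0)) a b)) (fun (a b : Fin 8) (l : Fin 6) => (if (((b : ℕ) = a ∨ (b : ℕ) = a + 1 ∨ (a : ℕ) = b + 1) ∧ l = (fun a b : Fin 8 => (if (b : ℕ) = a then (![5, 1, 0, 1, 0, 0, 0, 0] : Fin 8 → Fin 6) a else if (b : ℕ) = a + 1 then (![0, 0, 1, 1, 2, 3, 4, 0] : Fin 8 → Fin 6) a else if (a : ℕ) = b + 1 then (![0, 0,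 1, 1, 2, 3, 4, 0] : Fin 8 → Fin 6) b else 0)) a b) then (1 : ℤ) else 0)) (θ k) (p k)) ∧
      (∀ k : Fin 2, termSign (fun (a b : Fin 8) (l : Fin 6) => (if (((b : ℕ) = a ∨ (b : ℕ) = a + 1 ∨ (a : ℕ) = b + 1) ∧ l = (fun a b : Fin 8 => (if (b : ℕ) = a then (![5, 1, 0, 1, 0, 0, 0, 0] : Fin 8 → Fin 6) a else if (b : ℕ) = a + 1 then (![0, 0, 1, 1, 2, 3, 4, 0] : Fin 8 → Fin 6) a else if (a : ℕ) = b + 1 then (![0, 0, 1, 1, 2, 3, 4, 0] : Fin 8 → Fin 6) b else 0)) a b) then (1 : ℤ) else 0)) (p k.castSucc) * termSign (fun (a b : Fin 8) (l : Fin 6) => (if (((b : ℕ) = a ∨ (b : ℕ) = a + 1 ∨ (a : ℕ) = b + 1) ∧ l = (fun a b : Fin 8 => (if (b : ℕ) = a then (![5, 1, 0, 1, 0, 0, 0, 0] : Fin 8 → Fin 6) a else if (b : ℕ) = a + 1 then (![0, 0, 1, 1, 2, 3, 4, 0] : Fin 8 → Fin 6) a else if (a : ℕ) = b + 1 then (![0,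 0, 1, 1, 2, 3, 4, 0] : Fin 8 → Fin 6) b else 0)) a b) then (1 : ℤ) else 0)) (p k.succ) < 0)) ∧
    (∑ l, (X : ℝ[X]) ^ (![0, 1, 5, 6, 40, 59] : Fin 6 → ℕ) l • (patchMatrix 2 (fun (a b : Fin 8) (_ : Fin 6) => -((fun a b : Fin 8 => (if (b : ℕ) = a then (![120, 0, 2, 0, 0, 0, 1, 1] : Fin 8 → ℤ) a else if (b : ℕ) = a + 1 then (![0, 1, 0, 1, 0, 3, 6, 0] : Fin 8 → ℤ) a else if (a : ℕ) = b + 1 then (![0, 1, 0, 1, 0, 3, 6, 0] : Fin 8 → ℤ) b else 0)) a b)) (fun (a b : Fin 8) (l : Fin 6) => (if (((b : ℕ) = a ∨ (b : ℕ) = a + 1 ∨ (a : ℕ) = b + 1) ∧ l = (fun a b : Fin 8 => (if (b : ℕ) = a then (![5, 1, 0, 1, 0, 0, 0, 0] : Fin 8 → Fin 6) a else if (b : ℕ) = a + 1 then (![0, 0, 1, 1, 2, 3, 4, 0] : Fin 8 → Fin 6) a else if (a : ℕ) = b + 1 then (![0, 0, 1, 1, 2, 3, 4, 0] : Fin 8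 → Fin 6) b else 0)) a b) then (1 : ℤ) else 0)) l).map C) =
      (ctPath
        (fun t : ℕ => if t = 0 then (C (1329227995784915872903807060280344576 : ℝ) * X ^ 59 : ℝ[X]) else if t = 1 then (X : ℝ[X]) else if t = 2 then (C (4 : ℝ) : ℝ[X]) else if t = 3 then (X : ℝ[X]) else if t = 4 then (1 : ℝ[X]) else if t = 5 then (1 : ℝ[X]) else if t = 6 then (C (2 : ℝ) : ℝ[X]) else if t = 7 then (C (2 : ℝ) : ℝ[X]) else (0 : ℝ[X]))
        (fun t : ℕ => if t = 0 then (1 : ℝ[X]) else if t = 1 then (C (2 : ℝ) : ℝ[X]) else if t = 2 then (X : ℝ[X]) else if t = 3 then (C (2 : ℝ) * X : ℝ[X]) else if t = 4 then (X ^ 5 : ℝ[X]) else if t = 5 then (C (8 : ℝ) * X ^ 6 : ℝ[X]) else if t = 6 then (C (64 : ℝ) * X ^ 40 : ℝ[X]) else (0 : ℝ[X]))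
        (fun t : ℕ => if t = 0 then (0 : ℝ[X]) else if t = 1 then (1 : ℝ[X]) else if t = 2 then (C (2 : ℝ) : ℝ[X]) else if t = 3 then (X : ℝ[X]) else if t = 4 then (C (2 : ℝ) * X : ℝ[X]) else if t = 5 then (X ^ 5 : ℝ[X]) else if t = 6 then (C (8 : ℝ) * X ^ 6 : ℝ[X]) else if t = 7 then (C (64 : ℝ) * X ^ 40 : ℝ[X]) else (0 : ℝ[X])) 8) ∧
    10 ≤ (((∑ l, (X : ℝ[X]) ^ (![0, 1, 5, 6, 40, 59] : Fin 6 → ℕ) l • (patchMatrix 2 (fun (a b : Fin 8) (_ : Fin 6) => -((fun a b : Fin 8 => (if (b : ℕ) = a then (![120, 0, 2, 0, 0, 0, 1, 1] : Fin 8 → ℤ) a else if (b : ℕ) = a + 1 then (![0, 1, 0, 1, 0, 3, 6, 0] : Fin 8 → ℤ) a else if (a : ℕ) = b + 1 then (![0, 1, 0, 1, 0, 3, 6, 0] : Fin 8 → ℤ) b else 0)) a b)) (fun (a b : Fin 8) (l : Fin 6) => (if (((b : ℕ) = a ∨ (b : ℕ) = a + 1 ∨ (a : ℕ) = b + 1)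 ∧ l = (fun a b : Fin 8 => (if (b : ℕ) = a then (![5, 1, 0, 1, 0, 0, 0, 0] : Fin 8 → Fin 6) a else if (b : ℕ) = a + 1 then (![0, 0, 1, 1, 2, 3, 4, 0] : Fin 8 → Fin 6) a else if (a : ℕ) = b + 1 then (![0, 0, 1, 1, 2, 3, 4, 0] : Fin 8 → Fin 6) b else 0)) a b) then (1 : ℤ) else 0)) l).map C)).det.roots.toFinset.filter (fun t => 0 < t)).card := by
  -- generic steps (local copies of `…PumpShadow`'s tools, specialised to this design)
  have sum_le_of_potential : ∀ (ε : Fin 8 → Fin 8 → Fin 6 → ℤ) (g : Fin 8 → Fin 8 → Fin 6 → ℤ) (u w : Fin 8 → ℤ),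
      (∀ a b l, ε a b l ≠ 0 → g a b l ≤ u a + w b) → ∀ p : Equiv.Perm (Fin 8) × (Fin 8 → Fin 6), termSign ε p ≠ 0 → ∀ V : ℤ, ∑ a, u a + ∑ b, w b ≤ V →
      ∑ i, g (p.1 i) i (p.2 i) ≤ V := by
    intro ε g u w h p hp V hV
    calc ∑ i, g (p.1 i) i (p.2 i) ≤ ∑ i, (u (p.1 i) + w i) :=
          Finset.sum_le_sum fun i _ => h _ _ _ (present_of_termSign_ne_zero ε p hp i)
      _ = ∑ a, u a + ∑ b, w b := by rw [Finset.sum_add_distrib, Equiv.sum_comp p.1 u]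
      _ ≤ V := hV
  have tropWeight_affine : ∀ (θ θ₀ : ℤ) (p : Equiv.Perm (Fin 8) × (Fin 8 → Fin 6)),
      tropWeight (![0, 1, 5, 6, 40, 59] : Fin 6 → ℕ) (fun (a b : Fin 8) (_ : Fin 6) => -((fun a b : Fin 8 => (if (b : ℕ) = a then (![120, 0, 2, 0, 0, 0, 1, 1] : Fin 8 → ℤ) a else if (b : ℕ) = a + 1 then (![0, 1, 0, 1, 0, 3, 6, 0] : Fin 8 → ℤ) a else if (a : ℕ) = b + 1 then (![0, 1, 0, 1, 0, 3, 6, 0] : Fin 8 → ℤ) b else 0)) a b)) θ p = tropWeight (![0, 1, 5, 6, 40, 59] : Fin 6 → ℕ) (fun (a b : Fin 8) (_ : Fin 6) => -((fun a b : Fin 8 => (if (b : ℕ) = a then (![120, 0, 2, 0, 0, 0, 1, 1] : Fin 8 → ℤ) a else if (b : ℕ) = a + 1 then (![0, 1, 0, 1, 0, 3, 6, 0] : Fin 8 → ℤ) a else if (a : ℕ) = b + 1 then (![0, 1, 0, 1, 0, 3, 6, 0] : Fin 8 → ℤ) b else 0)) a b)) θ₀ p + (θ - θ₀) * ∑ i,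 ((![0, 1, 5, 6, 40, 59] : Fin 6 → ℕ) (p.2 i) : ℤ) := by
    intro θ θ₀ p
    unfold tropWeight
    ring
  have eq_of_isDominant : ∀ (θ : ℤ) (p q : Equiv.Perm (Fin 8) × (Fin 8 → Fin 6)), IsDominant (![0, 1, 5, 6, 40, 59] : Fin 6 → ℕ) (fun (a b : Fin 8) (_ : Fin 6) => -((fun a b : Fin 8 => (if (b : ℕ) = a then (![120, 0, 2, 0, 0, 0, 1, 1] : Fin 8 → ℤ) a else if (b : ℕ) = a + 1 then (![0, 1, 0, 1, 0, 3, 6, 0] : Fin 8 → ℤ) a else if (a : ℕ) = b + 1 then (![0, 1, 0, 1, 0, 3, 6, 0] : Fin 8 → ℤ) b else 0)) a b)) (fun (a b : Fin 8) (l : Fin 6) => (if (((b : ℕ) = a ∨ (b : ℕ) = a + 1 ∨ (a : ℕ) = b + 1) ∧ l = (fun a b : Fin 8 => (if (b : ℕ) = a then (![5, 1, 0, 1, 0, 0, 0, 0] : Fin 8 → Fin 6) a else if (b : ℕ) = a + 1 then (![0, 0, 1, 1, 2, 3, 4, 0] : Fin 8 → Fin 6) a else if (a : ℕ) = b + 1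 then (![0, 0, 1, 1, 2, 3, 4, 0] : Fin 8 → Fin 6) b else 0)) a b) then (1 : ℤ) else 0)) θ p → IsDominant (![0, 1, 5, 6, 40, 59] : Fin 6 → ℕ) (fun (a b : Fin 8) (_ : Fin 6) => -((fun a b : Fin 8 => (if (b : ℕ) = a then (![120, 0, 2, 0, 0, 0, 1, 1] : Fin 8 → ℤ) a else if (b : ℕ) = a + 1 then (![0, 1, 0, 1, 0, 3, 6, 0] : Fin 8 → ℤ) a else if (a : ℕ) = b + 1 then (![0, 1, 0, 1, 0, 3, 6, 0] : Fin 8 → ℤ) b else 0)) a b)) (fun (a b : Fin 8) (l : Fin 6) => (if (((b : ℕ) = a ∨ (b : ℕ) = a + 1 ∨ (a : ℕ) = b + 1) ∧ l = (fun a b : Fin 8 => (if (b : ℕ) = a then (![5, 1, 0, 1, 0, 0, 0, 0] : Fin 8 → Fin 6) a else if (b : ℕ) = a + 1 then (![0, 0, 1, 1, 2, 3, 4, 0] : Fin 8 → Fin 6) a else if (a : ℕ) = b + 1 then (![0, 0, 1, 1, 2, 3, 4, 0] : Fin 8 → Fin 6) b else 0)) a b) then (1 : ℤ) else 0)) θ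 q → p = q := by
    intro θ p q hp hq
    by_contra hne
    exact lt_asymm (hp.2 q (Ne.symm hne) hq.1) (hq.2 p hne hp.1)
  have not_isDominant_of_tie : ∀ (θ W : ℤ), (∀ p : Equiv.Perm (Fin 8) × (Fin 8 → Fin 6), termSign (fun (a b : Fin 8) (l : Fin 6) => (if (((b : ℕ) = a ∨ (b : ℕ) = a + 1 ∨ (a : ℕ) = b + 1) ∧ l = (fun a b : Fin 8 => (if (b : ℕ) = a then (![5, 1, 0, 1, 0, 0, 0, 0] : Fin 8 → Fin 6) a else if (b : ℕ) = a + 1 then (![0, 0, 1, 1, 2, 3, 4, 0] : Fin 8 → Fin 6) a else if (a : ℕ) = b + 1 then (![0, 0, 1, 1, 2, 3, 4, 0] : Fin 8 → Fin 6) b else 0)) a b) then (1 : ℤ) else 0)) p ≠ 0 → tropWeight (![0, 1, 5, 6, 40, 59] : Fin 6 → ℕ) (fun (a b : Fin 8) (_ : Fin 6) => -((fun a b : Fin 8 => (if (b : ℕ) = a then (![120, 0, 2, 0, 0, 0, 1, 1] : Fin 8 → ℤ) a else if (b : ℕ) = a + 1 then (![0, 1, 0, 1, 0, 3, 6, 0]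 : Fin 8 → ℤ) a else if (a : ℕ) = b + 1 then (![0, 1, 0, 1, 0, 3, 6, 0] : Fin 8 → ℤ) b else 0)) a b)) θ p ≤ W) →
      ∀ q₁ q₂ : Equiv.Perm (Fin 8) × (Fin 8 → Fin 6), q₁ ≠ q₂ → termSign (fun (a b : Fin 8) (l : Fin 6) => (if (((b : ℕ) = a ∨ (b : ℕ) = a + 1 ∨ (a : ℕ) = b + 1) ∧ l = (fun a b : Fin 8 => (if (b : ℕ) = a then (![5, 1, 0, 1, 0, 0, 0, 0] : Fin 8 → Fin 6) a else if (b : ℕ) = a + 1 then (![0, 0, 1, 1, 2, 3, 4, 0] : Fin 8 → Fin 6) a else if (a : ℕ) = b + 1 then (![0, 0, 1, 1, 2, 3, 4, 0] : Fin 8 → Fin 6) b else 0)) a b) then (1 : ℤ) else 0)) q₁ ≠ 0 → termSign (fun (a b : Fin 8) (l : Fin 6) => (if (((b : ℕ) = a ∨ (b : ℕ) = a + 1 ∨ (a : ℕ) = b + 1) ∧ l = (fun a b : Fin 8 => (if (b : ℕ) = a then (![5, 1, 0, 1, 0, 0, 0, 0] : Fin 8 → Fin 6) a else if (b : ℕ)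 = a + 1 then (![0, 0, 1, 1, 2, 3, 4, 0] : Fin 8 → Fin 6) a else if (a : ℕ) = b + 1 then (![0, 0, 1, 1, 2, 3, 4, 0] : Fin 8 → Fin 6) b else 0)) a b) then (1 : ℤ) else 0)) q₂ ≠ 0 →
      tropWeight (![0, 1, 5, 6, 40, 59] : Fin 6 → ℕ) (fun (a b : Fin 8) (_ : Fin 6) => -((fun a b : Fin 8 => (if (b : ℕ) = a then (![120, 0, 2, 0, 0, 0, 1, 1] : Fin 8 → ℤ) a else if (b : ℕ) = a + 1 then (![0, 1, 0, 1, 0, 3, 6, 0] : Fin 8 → ℤ) a else if (a : ℕ) = b + 1 then (![0, 1, 0, 1, 0, 3, 6, 0] : Fin 8 → ℤ) b else 0)) a b)) θ q₁ = W → tropWeight (![0, 1, 5, 6, 40, 59] : Fin 6 → ℕ) (fun (a b : Fin 8) (_ : Fin 6) => -((fun a b : Fin 8 => (if (b : ℕ) = a then (![120, 0, 2, 0, 0, 0, 1, 1] : Fin 8 → ℤ) a else if (b : ℕ) = a + 1 then (![0, 1, 0, 1, 0, 3, 6, 0] : Fin 8 → ℤ) a else if (a : ℕ) = b + 1 then (![0,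 1, 0, 1, 0, 3, 6, 0] : Fin 8 → ℤ) b else 0)) a b)) θ q₂ = W → ∀ p : Equiv.Perm (Fin 8) × (Fin 8 → Fin 6), ¬ IsDominant (![0, 1, 5, 6, 40, 59] : Fin 6 → ℕ) (fun (a b : Fin 8) (_ : Fin 6) => -((fun a b : Fin 8 => (if (b : ℕ) = a then (![120, 0, 2, 0, 0, 0, 1, 1] : Fin 8 → ℤ) a else if (b : ℕ) = a + 1 then (![0, 1, 0, 1, 0, 3, 6, 0] : Fin 8 → ℤ) a else if (a : ℕ) = b + 1 then (![0, 1, 0, 1, 0, 3, 6, 0] : Fin 8 → ℤ) b else 0)) a b)) (fun (a b : Fin 8) (l : Fin 6) => (if (((b : ℕ) = a ∨ (b : ℕ) = a + 1 ∨ (a : ℕ) = b + 1) ∧ l = (fun a b : Fin 8 => (if (b : ℕ) = a then (![5, 1, 0, 1, 0, 0, 0, 0] : Fin 8 → Fin 6) a else if (b : ℕ) = a + 1 then (![0, 0, 1, 1, 2, 3, 4, 0] : Fin 8 → Fin 6) a else if (a : ℕ) = b + 1 then (![0, 0, 1, 1, 2, 3, 4, 0] : Fin 8 → Fin 6) b else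 0)) a b) then (1 : ℤ) else 0)) θ p := by
    intro θ W hW q₁ q₂ hne h₁ h₂ w₁ w₂ p hp
    by_cases h : p = q₁
    · subst h
      have := hp.2 q₂ (Ne.symm hne) h₂
      rw [w₁, w₂] at this
      exact lt_irrefl _ this
    · have h3 := hp.2 q₁ (Ne.symm h) h₁
      have h4 := hW p hp.1
      rw [w₁] at h3
      exact absurd (lt_of_lt_of_le h3 h4) (lt_irrefl _)
  -- (a) four strict certificates
  have h3m : IsDominant (![0, 1, 5, 6, 40, 59] : Fin 6 → ℕ) (fun (a b : Fin 8) (_ : Fin 6) => -((fun a b : Fin 8 => (if (b : ℕ) = a then (![120, 0, 2, 0, 0, 0, 1, 1] : Fin 8 → ℤ) a else if (b : ℕ) = a + 1 then (![0, 1, 0, 1, 0, 3, 6, 0] : Fin 8 → ℤ) a else if (a : ℕ) = b + 1 then (![0, 1, 0, 1, 0, 3, 6, 0] : Fin 8 → ℤ) b else 0)) a b)) (fun (a b : Fin 8) (l : Fin 6) => (if (((b : ℕ) = a ∨ (b : ℕ) = a + 1 ∨ (a : ℕ) = b + 1) ∧ l = (fun a b : Fin 8 => (if (b : ℕ) = a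 then (![5, 1, 0, 1, 0, 0, 0, 0] : Fin 8 → Fin 6) a else if (b : ℕ) = a + 1 then (![0, 0, 1, 1, 2, 3, 4, 0] : Fin 8 → Fin 6) a else if (a : ℕ) = b + 1 then (![0, 0, 1, 1, 2, 3, 4, 0] : Fin 8 → Fin 6) b else 0)) a b) then (1 : ℤ) else 0)) (-3) (((Equiv.swap (0 : Fin 8) 1 : Equiv.Perm (Fin 8)), fun i => (fun a b : Fin 8 => (if (b : ℕ) = a then (![5, 1, 0, 1, 0, 0, 0, 0] : Fin 8 → Fin 6) a else if (b : ℕ) = a + 1 then (![0, 0, 1, 1, 2, 3, 4, 0] : Fin 8 → Fin 6) a else if (a : ℕ) = b + 1 then (![0, 0, 1, 1, 2, 3, 4, 0] : Fin 8 → Fin 6) b else 0)) ((Equiv.swap (0 : Fin 8) 1 : Equiv.Perm (Fin 8)) i) i) : Equiv.Perm (Fin 8) × (Fin 8 → Fin 6)) :=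
    isDominant_of_scaledPotential _ _ _ (-3) (Equiv.swap (0 : Fin 8) 1 : Equiv.Perm (Fin 8)) (fun i => (fun a b : Fin 8 => (if (b : ℕ) = a then (![5, 1, 0, 1, 0, 0, 0, 0] : Fin 8 → Fin 6) a else if (b : ℕ) = a + 1 then (![0, 0, 1, 1, 2, 3, 4, 0] : Fin 8 → Fin 6) a else if (a : ℕ) = b + 1 then (![0, 0, 1, 1, 2, 3, 4, 0] : Fin 8 → Fin 6) b else 0)) ((Equiv.swap (0 : Fin 8) 1 : Equiv.Perm (Fin 8)) i) i) 4 (by norm_num) (![0, 2, 5, 0, 5, 0, 0, 0] : Fin 8 → ℤ) (![-2, 0, 3, -12, -5, 0, 4, 4] : Fin 8 → ℤ)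
      (by decide +kernel) (by decide +kernel) (by decide +kernel)
  have hm1 : IsDominant (![0, 1, 5, 6, 40, 59] : Fin 6 → ℕ) (fun (a b : Fin 8) (_ : Fin 6) => -((fun a b : Fin 8 => (if (b : ℕ) = a then (![120, 0, 2, 0, 0, 0, 1, 1] : Fin 8 → ℤ) a else if (b : ℕ) = a + 1 then (![0, 1, 0, 1, 0, 3, 6, 0] : Fin 8 → ℤ) a else if (a : ℕ) = b + 1 then (![0, 1, 0, 1, 0, 3, 6, 0] : Fin 8 → ℤ) b else 0)) a b)) (fun (a b : Fin 8) (l : Fin 6) => (if (((b : ℕ) = a ∨ (b : ℕ) = a + 1 ∨ (a : ℕ) = b + 1) ∧ l = (fun a b : Fin 8 => (if (b : ℕ) = a then (![5, 1, 0, 1, 0, 0, 0, 0] : Fin 8 → Fin 6) a else if (b : ℕ) = a + 1 then (![0, 0, 1, 1, 2, 3, 4, 0] : Fin 8 → Fin 6) a else if (a : ℕ) = b + 1 then (![0, 0, 1, 1, 2, 3, 4, 0] : Fin 8 → Fin 6) b else 0)) a b) then (1 : ℤ) else 0)) (-1) (((Equiv.swap (1 : Fin 8) 2 * Equiv.swap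 (3 : Fin 8) 4 : Equiv.Perm (Fin 8)), fun i => (fun a b : Fin 8 => (if (b : ℕ) = a then (![5, 1, 0, 1, 0, 0, 0, 0] : Fin 8 → Fin 6) a else if (b : ℕ) = a + 1 then (![0, 0, 1, 1, 2, 3, 4, 0] : Fin 8 → Fin 6) a else if (a : ℕ) = b + 1 then (![0, 0, 1, 1, 2, 3, 4, 0] : Fin 8 → Fin 6) b else 0)) ((Equiv.swap (1 : Fin 8) 2 * Equiv.swap (3 : Fin 8) 4 : Equiv.Perm (Fin 8)) i) i) : Equiv.Perm (Fin 8) × (Fin 8 → Fin 6)) :=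
    isDominant_of_scaledPotential _ _ _ (-1) (Equiv.swap (1 : Fin 8) 2 * Equiv.swap (3 : Fin 8) 4 : Equiv.Perm (Fin 8)) (fun i => (fun a b : Fin 8 => (if (b : ℕ) = a then (![5, 1, 0, 1, 0, 0, 0, 0] : Fin 8 → Fin 6) a else if (b : ℕ) = a + 1 then (![0, 0, 1, 1, 2, 3, 4, 0] : Fin 8 → Fin 6) a else if (a : ℕ) = b + 1 then (![0, 0, 1, 1, 2, 3, 4, 0] : Fin 8 → Fin 6) b else 0)) ((Equiv.swap (1 : Fin 8) 2 * Equiv.swap (3 : Fin 8) 4 : Equiv.Perm (Fin 8)) i) i) 4 (by norm_num) (![2, 0, 5, 0, 1, 0, 0, 0] : Fin 8 → ℤ) (![242, -1, 4, -1, 0, 0, 4, 4] : Fin 8 → ℤ)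
      (by decide +kernel) (by decide +kernel) (by decide +kernel)
  have h1 : IsDominant (![0, 1, 5, 6, 40, 59] : Fin 6 → ℕ) (fun (a b : Fin 8) (_ : Fin 6) => -((fun a b : Fin 8 => (if (b : ℕ) = a then (![120, 0, 2, 0, 0, 0, 1, 1] : Fin 8 → ℤ) a else if (b : ℕ) = a + 1 then (![0, 1, 0, 1, 0, 3, 6, 0] : Fin 8 → ℤ) a else if (a : ℕ) = b + 1 then (![0, 1, 0, 1, 0, 3, 6, 0] : Fin 8 → ℤ) b else 0)) a b)) (fun (a b : Fin 8) (l : Fin 6) => (if (((b : ℕ) = a ∨ (b : ℕ) = a + 1 ∨ (a : ℕ) = b + 1) ∧ l = (fun a b : Fin 8 => (if (b : ℕ) = a then (![5, 1, 0, 1, 0, 0, 0, 0] : Fin 8 → Fin 6) a else if (b : ℕ) = a + 1 then (![0, 0, 1, 1, 2, 3, 4, 0] : Fin 8 → Fin 6) a else if (a : ℕ) = b + 1 then (![0, 0, 1, 1, 2, 3, 4, 0] : Fin 8 → Fin 6) b else 0)) a b) then (1 : ℤ) else 0)) 1 (((Equiv.swap (4 : Fin 8) 5 * Equiv.swap (6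 : Fin 8) 7 : Equiv.Perm (Fin 8)), fun i => (fun a b : Fin 8 => (if (b : ℕ) = a then (![5, 1, 0, 1, 0, 0, 0, 0] : Fin 8 → Fin 6) a else if (b : ℕ) = a + 1 then (![0, 0, 1, 1, 2, 3, 4, 0] : Fin 8 → Fin 6) a else if (a : ℕ) = b + 1 then (![0, 0, 1, 1, 2, 3, 4, 0] : Fin 8 → Fin 6) b else 0)) ((Equiv.swap (4 : Fin 8) 5 * Equiv.swap (6 : Fin 8) 7 : Equiv.Perm (Fin 8)) i) i) : Equiv.Perm (Fin 8) × (Fin 8 → Fin 6)) :=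
    isDominant_of_scaledPotential _ _ _ 1 (Equiv.swap (4 : Fin 8) 5 * Equiv.swap (6 : Fin 8) 7 : Equiv.Perm (Fin 8)) (fun i => (fun a b : Fin 8 => (if (b : ℕ) = a then (![5, 1, 0, 1, 0, 0, 0, 0] : Fin 8 → Fin 6) a else if (b : ℕ) = a + 1 then (![0, 0, 1, 1, 2, 3, 4, 0] : Fin 8 → Fin 6) a else if (a : ℕ) = b + 1 then (![0, 0, 1, 1, 2, 3, 4, 0] : Fin 8 → Fin 6) b else 0)) ((Equiv.swap (4 : Fin 8) 5 * Equiv.swap (6 : Fin 8) 7 : Equiv.Perm (Fin 8)) i) i) 4 (by norm_num) (![0, 0, 1, 0, 5, 0, 22, 0] : Fin 8 → ℤ) (![716, 4, 7, 4, 20, 15, 184, 162] : Fin 8 → ℤ)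
      (by decide +kernel) (by decide +kernel) (by decide +kernel)
  have h3p : IsDominant (![0, 1, 5, 6, 40, 59] : Fin 6 → ℕ) (fun (a b : Fin 8) (_ : Fin 6) => -((fun a b : Fin 8 => (if (b : ℕ) = a then (![120, 0, 2, 0, 0, 0, 1, 1] : Fin 8 → ℤ) a else if (b : ℕ) = a + 1 then (![0, 1, 0, 1, 0, 3, 6, 0] : Fin 8 → ℤ) a else if (a : ℕ) = b + 1 then (![0, 1, 0, 1, 0, 3, 6, 0] : Fin 8 → ℤ) b else 0)) a b)) (fun (a b : Fin 8) (l : Fin 6) => (if (((b : ℕ) = a ∨ (b : ℕ) = a + 1 ∨ (a : ℕ) = b + 1) ∧ l = (fun a b : Fin 8 => (if (b : ℕ) = a then (![5, 1, 0, 1, 0, 0, 0, 0] : Fin 8 → Fin 6) a else if (b : ℕ) = a + 1 then (![0, 0, 1, 1, 2, 3, 4, 0] : Fin 8 → Fin 6) a else if (a : ℕ) = b + 1 then (![0, 0, 1, 1, 2, 3, 4, 0] : Fin 8 → Fin 6) b else 0)) a b) then (1 : ℤ) else 0)) 3 (((Equiv.swap (2 : Fin 8) 3 * Equiv.swap (4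 : Fin 8) 5 * Equiv.swap (6 : Fin 8) 7 : Equiv.Perm (Fin 8)), fun i => (fun a b : Fin 8 => (if (b : ℕ) = a then (![5, 1, 0, 1, 0, 0, 0, 0] : Fin 8 → Fin 6) a else if (b : ℕ) = a + 1 then (![0, 0, 1, 1, 2, 3, 4, 0] : Fin 8 → Fin 6) a else if (a : ℕ) = b + 1 then (![0, 0, 1, 1, 2, 3, 4, 0] : Fin 8 → Fin 6) b else 0)) ((Equiv.swap (2 : Fin 8) 3 * Equiv.swap (4 : Fin 8) 5 * Equiv.swap (6 : Fin 8) 7 : Equiv.Perm (Fin 8)) i) i) : Equiv.Perm (Fin 8) × (Fin 8 → Fin 6)) :=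
    isDominant_of_scaledPotential _ _ _ 3 (Equiv.swap (2 : Fin 8) 3 * Equiv.swap (4 : Fin 8) 5 * Equiv.swap (6 : Fin 8) 7 : Equiv.Perm (Fin 8)) (fun i => (fun a b : Fin 8 => (if (b : ℕ) = a then (![5, 1, 0, 1, 0, 0, 0, 0] : Fin 8 → Fin 6) a else if (b : ℕ) = a + 1 then (![0, 0, 1, 1, 2, 3, 4, 0] : Fin 8 → Fin 6) a else if (a : ℕ) = b + 1 then (![0, 0, 1, 1, 2, 3, 4, 0] : Fin 8 → Fin 6) b else 0)) ((Equiv.swap (2 : Fin 8) 3 * Equiv.swap (4 : Fin 8) 5 * Equiv.swap (6 : Fin 8) 7 : Equiv.Perm (Fin 8)) i) i) 4 (by norm_num) (![0, 0, 0, 1, 5, 0, 30, 0] : Fin 8 → ℤ) (![1188, 12, 11, 12, 60, 55, 504, 474] : Fin 8 → ℤ)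
      (by decide +kernel) (by decide +kernel) (by decide +kernel)
  -- (b) extremal total exponents: `1 ≤ ∑ d ≤ 152`, attained by `{0}` and `{2,4,6}`
  have hsmax : ∀ p : Equiv.Perm (Fin 8) × (Fin 8 → Fin 6), termSign (fun (a b : Fin 8) (l : Fin 6) => (if (((b : ℕ) = a ∨ (b : ℕ) = a + 1 ∨ (a : ℕ) = b + 1) ∧ l = (fun a b : Fin 8 => (if (b : ℕ) = a then (![5, 1, 0, 1, 0, 0, 0, 0] : Fin 8 → Fin 6) a else if (b : ℕ) = a + 1 then (![0, 0, 1, 1, 2, 3, 4, 0] : Fin 8 → Fin 6) a else if (a : ℕ) = b + 1 then (![0, 0, 1, 1, 2, 3, 4, 0] : Fin 8 → Fin 6) b else 0)) a b) then (1 : ℤ) else 0)) p ≠ 0 → ∑ i, ((![0, 1, 5, 6, 40, 59] : Fin 6 → ℕ) (p.2 i) : ℤ) ≤ ∑ i, ((![0, 1, 5, 6, 40, 59] : Fin 6 → ℕ) (((((Equiv.swap (2 : Fin 8) 3 * Equiv.swap (4 : Fin 8) 5 * Equiv.swap (6 : Fin 8) 7 : Equiv.Perm (Fin 8)), fun i =>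 (fun a b : Fin 8 => (if (b : ℕ) = a then (![5, 1, 0, 1, 0, 0, 0, 0] : Fin 8 → Fin 6) a else if (b : ℕ) = a + 1 then (![0, 0, 1, 1, 2, 3, 4, 0] : Fin 8 → Fin 6) a else if (a : ℕ) = b + 1 then (![0, 0, 1, 1, 2, 3, 4, 0] : Fin 8 → Fin 6) b else 0)) ((Equiv.swap (2 : Fin 8) 3 * Equiv.swap (4 : Fin 8) 5 * Equiv.swap (6 : Fin 8) 7 : Equiv.Perm (Fin 8)) i) i) : Equiv.Perm (Fin 8) × (Fin 8 → Fin 6))).2 i) : ℤ) := by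
    intro p hp
    have hs : ∑ i, ((![0, 1, 5, 6, 40, 59] : Fin 6 → ℕ) (((((Equiv.swap (2 : Fin 8) 3 * Equiv.swap (4 : Fin 8) 5 * Equiv.swap (6 : Fin 8) 7 : Equiv.Perm (Fin 8)), fun i => (fun a b : Fin 8 => (if (b : ℕ) = a then (![5, 1, 0, 1, 0, 0, 0, 0] : Fin 8 → Fin 6) a else if (b : ℕ) = a + 1 then (![0, 0, 1, 1, 2, 3, 4, 0] : Fin 8 → Fin 6) a else if (a : ℕ) = b + 1 then (![0, 0, 1, 1, 2, 3, 4, 0] : Fin 8 → Fin 6) b else 0)) ((Equiv.swap (2 : Fin 8) 3 * Equiv.swap (4 : Fin 8) 5 * Equiv.swap (6 : Fin 8) 7 : Equiv.Perm (Fin 8)) i) i) : Equiv.Perm (Fin 8) × (Fin 8 → Fin 6))).2 i) : ℤ) = 152 := by decide +kernel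
    rw [hs]
    exact sum_le_of_potential (fun (a b : Fin 8) (l : Fin 6) => (if (((b : ℕ) = a ∨ (b : ℕ) = a + 1 ∨ (a : ℕ) = b + 1) ∧ l = (fun a b : Fin 8 => (if (b : ℕ) = a then (![5, 1, 0, 1, 0, 0, 0, 0] : Fin 8 → Fin 6) a else if (b : ℕ) = a + 1 then (![0, 0, 1, 1, 2, 3, 4, 0] : Fin 8 → Fin 6) a else if (a : ℕ) = b + 1 then (![0, 0, 1, 1, 2, 3, 4, 0] : Fin 8 → Fin 6) b else 0)) a b) then (1 : ℤ) else 0)) (fun _ _ l => ((![0, 1, 5, 6, 40, 59] : Fin 6 → ℕ) l : ℤ)) (![0, 0, 0, 0, 0, 0, 1, 0] : Fin 8 → ℤ) (![59, 1, 1, 1, 5, 5, 40, 39] : Fin 8 → ℤ) (by decide +kernel) p hp 152 (by decide +kernel)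
  have hsmin : ∀ p : Equiv.Perm (Fin 8) × (Fin 8 → Fin 6), termSign (fun (a b : Fin 8) (l : Fin 6) => (if (((b : ℕ) = a ∨ (b : ℕ) = a + 1 ∨ (a : ℕ) = b + 1) ∧ l = (fun a b : Fin 8 => (if (b : ℕ) = a then (![5, 1, 0, 1, 0, 0, 0, 0] : Fin 8 → Fin 6) a else if (b : ℕ) = a + 1 then (![0, 0, 1, 1, 2, 3, 4, 0] : Fin 8 → Fin 6) a else if (a : ℕ) = b + 1 then (![0, 0, 1, 1, 2, 3, 4, 0] : Fin 8 → Fin 6) b else 0)) a b) then (1 : ℤ) else 0)) p ≠ 0 → ∑ i, ((![0, 1, 5, 6, 40, 59] : Fin 6 → ℕ) (((((Equiv.swap (0 : Fin 8) 1 : Equiv.Perm (Fin 8)), fun i => (fun a b : Fin 8 => (if (b : ℕ) = a then (![5, 1, 0, 1, 0, 0, 0, 0] : Fin 8 → Fin 6) a else if (b : ℕ) = a + 1 then (![0, 0, 1, 1, 2, 3, 4, 0] : Fin 8 → Fin 6) a else if (a : ℕ) = b + 1 then (![0, 0, 1, 1, 2, 3, 4, 0] : Fin 8 → Fin 6) b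 else 0)) ((Equiv.swap (0 : Fin 8) 1 : Equiv.Perm (Fin 8)) i) i) : Equiv.Perm (Fin 8) × (Fin 8 → Fin 6))).2 i) : ℤ) ≤ ∑ i, ((![0, 1, 5, 6, 40, 59] : Fin 6 → ℕ) (p.2 i) : ℤ) := by
    intro p hp
    have hs : ∑ i, ((![0, 1, 5, 6, 40, 59] : Fin 6 → ℕ) (((((Equiv.swap (0 : Fin 8) 1 : Equiv.Perm (Fin 8)), fun i => (fun a b : Fin 8 => (if (b : ℕ) = a then (![5, 1, 0, 1, 0, 0, 0, 0] : Fin 8 → Fin 6) a else if (b : ℕ) = a + 1 then (![0, 0, 1, 1, 2, 3, 4, 0] : Fin 8 → Fin 6) a else if (a : ℕ) = b + 1 then (![0, 0, 1, 1, 2, 3, 4, 0] : Fin 8 → Fin 6) b else 0)) ((Equiv.swap (0 : Fin 8) 1 : Equiv.Perm (Fin 8)) i) i) : Equiv.Perm (Fin 8) × (Fin 8 → Fin 6))).2 i) : ℤ) = 1 := by decide +kernel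
    have h := sum_le_of_potential (fun (a b : Fin 8) (l : Fin 6) => (if (((b : ℕ) = a ∨ (b : ℕ) = a + 1 ∨ (a : ℕ) = b + 1) ∧ l = (fun a b : Fin 8 => (if (b : ℕ) = a then (![5, 1, 0, 1, 0, 0, 0, 0] : Fin 8 → Fin 6) a else if (b : ℕ) = a + 1 then (![0, 0, 1, 1, 2, 3, 4, 0] : Fin 8 → Fin 6) a else if (a : ℕ) = b + 1 then (![0, 0, 1, 1, 2, 3, 4, 0] : Fin 8 → Fin 6) b else 0)) a b) then (1 : ℤ) else 0)) (fun _ _ l => -((![0, 1, 5, 6, 40, 59] : Fin 6 → ℕ) l : ℤ)) (fun _ : Fin 8 => (0 : ℤ)) (![0, 0, 0, -1, 0, 0, 0, 0] : Fin 8 → ℤ) (by decide +kernel) p hp (-1) (by decide +kernel)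
    rw [Finset.sum_neg_distrib] at h
    rw [hs]
    linarith
  -- (c) three ties
  have htie2m : ∀ p : Equiv.Perm (Fin 8) × (Fin 8 → Fin 6), ¬ IsDominant (![0, 1, 5, 6, 40, 59] : Fin 6 → ℕ) (fun (a b : Fin 8) (_ : Fin 6) => -((fun a b : Fin 8 => (if (b : ℕ) = a then (![120, 0, 2, 0, 0, 0, 1, 1] : Fin 8 → ℤ) a else if (b : ℕ) = a + 1 then (![0, 1, 0, 1, 0, 3, 6, 0] : Fin 8 → ℤ) a else if (a : ℕ) = b + 1 then (![0, 1, 0, 1, 0, 3, 6, 0] : Fin 8 → ℤ) b else 0)) a b)) (fun (a b : Fin 8) (l : Fin 6) => (if (((b : ℕ) = a ∨ (b : ℕ) = a + 1 ∨ (a : ℕ) = b + 1) ∧ l = (fun a b : Fin 8 => (if (b : ℕ) = a then (![5, 1, 0, 1, 0, 0, 0, 0] : Fin 8 → Fin 6) a else if (b : ℕ) = a + 1 then (![0, 0, 1, 1, 2, 3, 4, 0] : Fin 8 → Fin 6) a else if (a : ℕ) = b + 1 then (![0, 0, 1, 1, 2, 3, 4, 0] : Fin 8 → Fin 6) b else 0))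 a b) then (1 : ℤ) else 0)) (-2) p := by
    refine not_isDominant_of_tie (-2) 4 (fun p hp => ?_) (((Equiv.swap (1 : Fin 8) 2 : Equiv.Perm (Fin 8)), fun i => (fun a b : Fin 8 => (if (b : ℕ) = a then (![5, 1, 0, 1, 0, 0, 0, 0] : Fin 8 → Fin 6) a else if (b : ℕ) = a + 1 then (![0, 0, 1, 1, 2, 3, 4, 0] : Fin 8 → Fin 6) a else if (a : ℕ) = b + 1 then (![0, 0, 1, 1, 2, 3, 4, 0] : Fin 8 → Fin 6) b else 0)) ((Equiv.swap (1 : Fin 8) 2 : Equiv.Perm (Fin 8)) i) i) : Equiv.Perm (Fin 8) × (Fin 8 → Fin 6)) (((Equiv.swap (1 : Fin 8) 2 * Equiv.swap (3 : Fin 8) 4 : Equiv.Perm (Fin 8)), fun i => (fun a b : Fin 8 => (if (b : ℕ) = a then (![5, 1, 0, 1, 0, 0, 0, 0] : Fin 8 → Fin 6) a else if (b : ℕ) = a + 1 then (![0, 0, 1, 1, 2, 3, 4, 0] : Fin 8 → Fin 6) a else if (a : ℕ) = b + 1 then (![0, 0, 1, 1, 2, 3, 4, 0] : Fin 8 → Fin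 6) b else 0)) ((Equiv.swap (1 : Fin 8) 2 * Equiv.swap (3 : Fin 8) 4 : Equiv.Perm (Fin 8)) i) i) : Equiv.Perm (Fin 8) × (Fin 8 → Fin 6)) ?_ ?_ ?_ (by decide +kernel) (by decide +kernel)
    · rw [tropWeight_eq_sum]
      exact sum_le_of_potential (fun (a b : Fin 8) (l : Fin 6) => (if (((b : ℕ) = a ∨ (b : ℕ) = a + 1 ∨ (a : ℕ) = b + 1) ∧ l = (fun a b : Fin 8 => (if (b : ℕ) = a then (![5, 1, 0, 1, 0, 0, 0, 0] : Fin 8 → Fin 6) a else if (b : ℕ) = a + 1 then (![0, 0, 1, 1, 2, 3, 4, 0] : Fin 8 → Fin 6) a else if (a : ℕ) = b + 1 then (![0, 0, 1, 1, 2, 3, 4, 0] : Fin 8 → Fin 6) b else 0)) a b) then (1 : ℤ) else 0)) (fun a b l => (-2) * ((![0, 1, 5, 6, 40, 59] : Fin 6 → ℕ) l : ℤ) - (fun (a b : Fin 8) (_ : Fin 6) => -((fun a b : Fin 8 => (if (b : ℕ) = a then (![120, 0, 2, 0, 0, 0, 1, 1] : Fin 8 → ℤ) a else if (b : ℕ)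 = a + 1 then (![0, 1, 0, 1, 0, 3, 6, 0] : Fin 8 → ℤ) a else if (a : ℕ) = b + 1 then (![0, 1, 0, 1, 0, 3, 6, 0] : Fin 8 → ℤ) b else 0)) a b)) a b l) (![0, 0, 1, 0, 1, 0, 0, 0] : Fin 8 → ℤ) (![2, 0, 1, -2, -1, 0, 1, 1] : Fin 8 → ℤ) (by decide +kernel) p hp 4
        (by decide +kernel)
    · intro h
      have h1 := congrArg (fun q : Equiv.Perm (Fin 8) × (Fin 8 → Fin 6) => q.1 3) h
      revert h1
      decide +kernel
    · exact mul_ne_zero (Units.ne_zero _) (by decide +kernel)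
    · exact mul_ne_zero (Units.ne_zero _) (by decide +kernel)
  have htie0 : ∀ p : Equiv.Perm (Fin 8) × (Fin 8 → Fin 6), ¬ IsDominant (![0, 1, 5, 6, 40, 59] : Fin 6 → ℕ) (fun (a b : Fin 8) (_ : Fin 6) => -((fun a b : Fin 8 => (if (b : ℕ) = a then (![120, 0, 2, 0, 0, 0, 1, 1] : Fin 8 → ℤ) a else if (b : ℕ) = a + 1 then (![0, 1, 0, 1, 0, 3, 6, 0] : Fin 8 → ℤ) a else if (a : ℕ) = b + 1 then (![0, 1, 0, 1, 0, 3, 6, 0] : Fin 8 → ℤ) b else 0)) a b)) (fun (a b : Fin 8) (l : Fin 6) => (if (((b : ℕ) = a ∨ (b : ℕ) = a + 1 ∨ (a : ℕ) = b + 1) ∧ l = (fun a b : Fin 8 => (if (b : ℕ) = a then (![5, 1, 0, 1, 0, 0, 0, 0] : Fin 8 → Fin 6) a else if (b : ℕ) = a + 1 then (![0, 0, 1, 1, 2, 3, 4, 0] : Fin 8 → Fin 6) a else if (a : ℕ) = b + 1 then (![0, 0, 1, 1, 2, 3, 4, 0] : Fin 8 → Fin 6) b else 0)) a b) then (1 :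 ℤ) else 0)) 0 p := by
    refine not_isDominant_of_tie 0 136 (fun p hp => ?_) (((Equiv.swap (1 : Fin 8) 2 * Equiv.swap (3 : Fin 8) 4 * Equiv.swap (6 : Fin 8) 7 : Equiv.Perm (Fin 8)), fun i => (fun a b : Fin 8 => (if (b : ℕ) = a then (![5, 1, 0, 1, 0, 0, 0, 0] : Fin 8 → Fin 6) a else if (b : ℕ) = a + 1 then (![0, 0, 1, 1, 2, 3, 4, 0] : Fin 8 → Fin 6) a else if (a : ℕ) = b + 1 then (![0, 0, 1, 1, 2, 3, 4, 0] : Fin 8 → Fin 6) b else 0)) ((Equiv.swap (1 : Fin 8) 2 * Equiv.swap (3 : Fin 8) 4 * Equiv.swap (6 : Fin 8) 7 : Equiv.Perm (Fin 8)) i) i) : Equiv.Perm (Fin 8) × (Fin 8 → Fin 6)) (((Equiv.swap (3 : Fin 8) 4 * Equiv.swap (6 : Fin 8) 7 : Equiv.Perm (Fin 8)), fun i => (fun a b : Fin 8 => (if (b : ℕ) = a then (![5, 1, 0, 1, 0, 0, 0, 0] : Fin 8 → Fin 6) a else if (b : ℕ) = a + 1 then (![0, 0, 1, 1, 2, 3,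 4, 0] : Fin 8 → Fin 6) a else if (a : ℕ) = b + 1 then (![0, 0, 1, 1, 2, 3, 4, 0] : Fin 8 → Fin 6) b else 0)) ((Equiv.swap (3 : Fin 8) 4 * Equiv.swap (6 : Fin 8) 7 : Equiv.Perm (Fin 8)) i) i) : Equiv.Perm (Fin 8) × (Fin 8 → Fin 6)) ?_ ?_ ?_ (by decide +kernel) (by decide +kernel)
    · rw [tropWeight_eq_sum]
      exact sum_le_of_potential (fun (a b : Fin 8) (l : Fin 6) => (if (((b : ℕ) = a ∨ (b : ℕ) = a + 1 ∨ (a : ℕ) = b + 1) ∧ l = (fun a b : Fin 8 => (if (b : ℕ) = a then (![5, 1, 0, 1, 0, 0, 0, 0] : Fin 8 → Fin 6) a else if (b : ℕ) = a + 1 then (![0, 0, 1, 1, 2, 3, 4, 0] : Fin 8 → Fin 6) a else if (a : ℕ) = b + 1 then (![0, 0, 1, 1, 2, 3, 4, 0] : Fin 8 → Fin 6) b else 0)) a b) then (1 : ℤ) else 0)) (fun a b l => 0 * ((![0, 1, 5, 6, 40, 59] : Fin 6 → ℕ) l : ℤ) - (fun (a b : Fin 8) (_ : Fin 6) => -((fun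 a b : Fin 8 => (if (b : ℕ) = a then (![120, 0, 2, 0, 0, 0, 1, 1] : Fin 8 → ℤ) a else if (b : ℕ) = a + 1 then (![0, 1, 0, 1, 0, 3, 6, 0] : Fin 8 → ℤ) a else if (a : ℕ) = b + 1 then (![0, 1, 0, 1, 0, 3, 6, 0] : Fin 8 → ℤ) b else 0)) a b)) a b l) (![0, 0, 1, 0, 0, 0, 3, 0] : Fin 8 → ℤ) (![120, 0, 1, 1, 1, 0, 6, 3] : Fin 8 → ℤ) (by decide +kernel) p hp 136
        (by decide +kernel)
    · intro h
      have h1 := congrArg (fun q : Equiv.Perm (Fin 8) × (Fin 8 → Fin 6) => q.1 1) h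
      revert h1
      decide +kernel
    · exact mul_ne_zero (Units.ne_zero _) (by decide +kernel)
    · exact mul_ne_zero (Units.ne_zero _) (by decide +kernel)
  have htie2p : ∀ p : Equiv.Perm (Fin 8) × (Fin 8 → Fin 6), ¬ IsDominant (![0, 1, 5, 6, 40, 59] : Fin 6 → ℕ) (fun (a b : Fin 8) (_ : Fin 6) => -((fun a b : Fin 8 => (if (b : ℕ) = a then (![120, 0, 2, 0, 0, 0, 1, 1] : Fin 8 → ℤ) a else if (b : ℕ) = a + 1 then (![0, 1, 0, 1, 0, 3, 6, 0] : Fin 8 → ℤ) a else if (a : ℕ) = b + 1 then (![0, 1, 0, 1, 0, 3, 6, 0] : Fin 8 → ℤ) b else 0)) a b)) (fun (a b : Fin 8) (l : Fin 6) => (if (((b : ℕ) = a ∨ (b : ℕ) = a + 1 ∨ (a : ℕ) = b + 1) ∧ l = (fun a b : Fin 8 => (if (b : ℕ) = a then (![5, 1, 0, 1, 0, 0, 0, 0] : Fin 8 → Fin 6) a else if (b : ℕ) = a + 1 then (![0, 0, 1, 1, 2, 3, 4, 0] : Fin 8 → Fin 6) a else if (a : ℕ) = b + 1 then (![0, 0,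 1, 1, 2, 3, 4, 0] : Fin 8 → Fin 6) b else 0)) a b) then (1 : ℤ) else 0)) 2 p := by
    refine not_isDominant_of_tie 2 436 (fun p hp => ?_) (((Equiv.swap (4 : Fin 8) 5 * Equiv.swap (6 : Fin 8) 7 : Equiv.Perm (Fin 8)), fun i => (fun a b : Fin 8 => (if (b : ℕ) = a then (![5, 1, 0, 1, 0, 0, 0, 0] : Fin 8 → Fin 6) a else if (b : ℕ) = a + 1 then (![0, 0, 1, 1, 2, 3, 4, 0] : Fin 8 → Fin 6) a else if (a : ℕ) = b + 1 then (![0, 0, 1, 1, 2, 3, 4, 0] : Fin 8 → Fin 6) b else 0)) ((Equiv.swap (4 : Fin 8) 5 * Equiv.swap (6 : Fin 8) 7 : Equiv.Perm (Fin 8)) i) i) : Equiv.Perm (Fin 8) × (Fin 8 → Fin 6)) (((Equiv.swap (2 : Fin 8) 3 * Equiv.swap (4 : Fin 8) 5 * Equiv.swap (6 : Fin 8) 7 : Equiv.Perm (Fin 8)), fun i => (fun a b : Fin 8 => (if (b : ℕ) = a then (![5, 1, 0, 1, 0, 0, 0, 0] : Fin 8 → Fin 6) a else if (b : ℕ) =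 a + 1 then (![0, 0, 1, 1, 2, 3, 4, 0] : Fin 8 → Fin 6) a else if (a : ℕ) = b + 1 then (![0, 0, 1, 1, 2, 3, 4, 0] : Fin 8 → Fin 6) b else 0)) ((Equiv.swap (2 : Fin 8) 3 * Equiv.swap (4 : Fin 8) 5 * Equiv.swap (6 : Fin 8) 7 : Equiv.Perm (Fin 8)) i) i) : Equiv.Perm (Fin 8) × (Fin 8 → Fin 6)) ?_ ?_ ?_ (by decide +kernel) (by decide +kernel)
    · rw [tropWeight_eq_sum]
      exact sum_le_of_potential (fun (a b : Fin 8) (l : Fin 6) => (if (((b : ℕ) = a ∨ (b : ℕ) = a + 1 ∨ (a : ℕ) = b + 1) ∧ l = (fun a b : Fin 8 => (if (b : ℕ) = a then (![5, 1, 0, 1, 0, 0, 0, 0] : Fin 8 → Fin 6) a else if (b : ℕ) = a + 1 then (![0, 0, 1, 1, 2, 3, 4, 0] : Fin 8 → Fin 6) a else if (a : ℕ) = b + 1 then (![0, 0, 1, 1, 2, 3, 4, 0] : Fin 8 → Fin 6) b else 0)) a b) then (1 : ℤ) else 0)) (fun a b l => 2 * ((![0, 1, 5, 6, 40, 59] :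 Fin 6 → ℕ) l : ℤ) - (fun (a b : Fin 8) (_ : Fin 6) => -((fun a b : Fin 8 => (if (b : ℕ) = a then (![120, 0, 2, 0, 0, 0, 1, 1] : Fin 8 → ℤ) a else if (b : ℕ) = a + 1 then (![0, 1, 0, 1, 0, 3, 6, 0] : Fin 8 → ℤ) a else if (a : ℕ) = b + 1 then (![0, 1, 0, 1, 0, 3, 6, 0] : Fin 8 → ℤ) b else 0)) a b)) a b l) (![0, 0, 0, 0, 1, 0, 6, 0] : Fin 8 → ℤ) (![238, 2, 2, 2, 10, 9, 86, 80] : Fin 8 → ℤ) (by decide +kernel) p hp 436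
        (by decide +kernel)
    · intro h
      have h1 := congrArg (fun q : Equiv.Perm (Fin 8) × (Fin 8 → Fin 6) => q.1 2) h
      revert h1
      decide +kernel
    · exact h1.1
    · exact h3p.1
  -- (d) classification
  have hclass : ∀ (θ : ℤ) (p : Equiv.Perm (Fin 8) × (Fin 8 → Fin 6)), IsDominant (![0, 1, 5, 6, 40, 59] : Fin 6 → ℕ) (fun (a b : Fin 8) (_ : Fin 6) => -((fun a b : Fin 8 => (if (b : ℕ) = a then (![120, 0, 2, 0, 0, 0, 1, 1] : Fin 8 → ℤ) a else if (b : ℕ) = a + 1 then (![0, 1, 0, 1, 0, 3, 6, 0] : Fin 8 → ℤ) a else if (a : ℕ) = b + 1 then (![0, 1, 0, 1, 0, 3, 6, 0] : Fin 8 → ℤ) b else 0)) a b)) (fun (a b : Fin 8) (l : Fin 6) => (if (((b : ℕ) = a ∨ (b : ℕ) = a + 1 ∨ (a : ℕ) = b + 1) ∧ l = (fun a b : Fin 8 => (if (b : ℕ) = a then (![5, 1, 0, 1, 0, 0, 0, 0] : Fin 8 → Fin 6) a else if (b : ℕ) = a + 1 then (![0, 0, 1, 1, 2, 3, 4, 0]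 : Fin 8 → Fin 6) a else if (a : ℕ) = b + 1 then (![0, 0, 1, 1, 2, 3, 4, 0] : Fin 8 → Fin 6) b else 0)) a b) then (1 : ℤ) else 0)) θ p ↔
      (θ ≤ -3 ∧ p = (((Equiv.swap (0 : Fin 8) 1 : Equiv.Perm (Fin 8)), fun i => (fun a b : Fin 8 => (if (b : ℕ) = a then (![5, 1, 0, 1, 0, 0, 0, 0] : Fin 8 → Fin 6) a else if (b : ℕ) = a + 1 then (![0, 0, 1, 1, 2, 3, 4, 0] : Fin 8 → Fin 6) a else if (a : ℕ) = b + 1 then (![0, 0, 1, 1, 2, 3, 4, 0] : Fin 8 → Fin 6) b else 0)) ((Equiv.swap (0 : Fin 8) 1 : Equiv.Perm (Fin 8)) i) i) : Equiv.Perm (Fin 8) × (Fin 8 → Fin 6))) ∨ (θ = -1 ∧ p = (((Equiv.swap (1 : Fin 8) 2 * Equiv.swap (3 : Fin 8) 4 : Equiv.Perm (Fin 8)), fun i => (fun a b : Fin 8 => (if (b : ℕ) = a then (![5, 1, 0, 1, 0, 0, 0, 0] : Fin 8 → Fin 6) a else if (b : ℕ) = a + 1 then (![0, 0, 1, 1,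 2, 3, 4, 0] : Fin 8 → Fin 6) a else if (a : ℕ) = b + 1 then (![0, 0, 1, 1, 2, 3, 4, 0] : Fin 8 → Fin 6) b else 0)) ((Equiv.swap (1 : Fin 8) 2 * Equiv.swap (3 : Fin 8) 4 : Equiv.Perm (Fin 8)) i) i) : Equiv.Perm (Fin 8) × (Fin 8 → Fin 6))) ∨ (θ = 1 ∧ p = (((Equiv.swap (4 : Fin 8) 5 * Equiv.swap (6 : Fin 8) 7 : Equiv.Perm (Fin 8)), fun i => (fun a b : Fin 8 => (if (b : ℕ) = a then (![5, 1, 0, 1, 0, 0, 0, 0] : Fin 8 → Fin 6) a else if (b : ℕ) = a + 1 then (![0, 0, 1, 1, 2, 3, 4, 0] : Fin 8 → Fin 6) a else if (a : ℕ) = b + 1 then (![0, 0, 1, 1, 2, 3, 4, 0] : Fin 8 → Fin 6) b else 0)) ((Equiv.swap (4 : Fin 8) 5 * Equiv.swap (6 : Fin 8) 7 : Equiv.Perm (Fin 8)) i) i) : Equiv.Perm (Fin 8) × (Fin 8 → Fin 6))) ∨ (3 ≤ θ ∧ p = (((Equiv.swap (2 : Fin 8) 3 * Equiv.swap (4 :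 Fin 8) 5 * Equiv.swap (6 : Fin 8) 7 : Equiv.Perm (Fin 8)), fun i => (fun a b : Fin 8 => (if (b : ℕ) = a then (![5, 1, 0, 1, 0, 0, 0, 0] : Fin 8 → Fin 6) a else if (b : ℕ) = a + 1 then (![0, 0, 1, 1, 2, 3, 4, 0] : Fin 8 → Fin 6) a else if (a : ℕ) = b + 1 then (![0, 0, 1, 1, 2, 3, 4, 0] : Fin 8 → Fin 6) b else 0)) ((Equiv.swap (2 : Fin 8) 3 * Equiv.swap (4 : Fin 8) 5 * Equiv.swap (6 : Fin 8) 7 : Equiv.Perm (Fin 8)) i) i) : Equiv.Perm (Fin 8) × (Fin 8 → Fin 6))) := by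
    intro θ p
    constructor
    · intro hp
      rcases le_or_gt θ (-3) with h | h
      · refine Or.inl ⟨h, eq_of_isDominant θ _ _ hp ⟨h3m.1, fun q hq hq' => ?_⟩⟩
        have e1 := h3m.2 q hq hq'
        rw [tropWeight_affine θ (-3) q, tropWeight_affine θ (-3)]
        have e3 : (-3 - θ) * ∑ i, ((![0, 1, 5, 6, 40, 59] : Fin 6 → ℕ) (((((Equiv.swap (0 : Fin 8) 1 : Equiv.Perm (Fin 8)), fun i => (fun a b : Fin 8 => (if (b : ℕ) = a then (![5, 1, 0, 1, 0, 0, 0, 0] : Fin 8 → Fin 6) a else if (b : ℕ) = a + 1 then (![0, 0, 1, 1, 2, 3, 4, 0] : Fin 8 → Fin 6) a else if (a : ℕ) = b + 1 then (![0, 0, 1, 1, 2, 3, 4, 0] : Fin 8 → Fin 6) b else 0)) ((Equiv.swap (0 : Fin 8) 1 : Equiv.Perm (Fin 8)) i) i) : Equiv.Perm (Fin 8) × (Fin 8 → Fin 6))).2 i) : ℤ) ≤ (-3 - θ) * ∑ i, ((![0, 1, 5, 6, 40, 59] : Fin 6 → ℕ) (q.2 i) : ℤ) :=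
          mul_le_mul_of_nonneg_left (hsmin q hq') (by linarith)
        linarith
      rcases le_or_gt 3 θ with h' | h'
      · refine Or.inr (Or.inr (Or.inr ⟨h', eq_of_isDominant θ _ _ hp ⟨h3p.1, fun q hq hq' => ?_⟩⟩))
        have e1 := h3p.2 q hq hq'
        rw [tropWeight_affine θ 3 q, tropWeight_affine θ 3]
        have e3 : (θ - 3) * ∑ i, ((![0, 1, 5, 6, 40, 59] : Fin 6 → ℕ) (q.2 i) : ℤ) ≤ (θ - 3) * ∑ i, ((![0, 1, 5, 6, 40, 59] : Fin 6 → ℕ) (((((Equiv.swap (2 : Fin 8) 3 * Equiv.swap (4 : Fin 8) 5 * Equiv.swap (6 : Fin 8) 7 : Equiv.Perm (Fin 8)), fun i => (fun a b : Fin 8 => (if (b : ℕ) = a then (![5, 1, 0, 1, 0, 0, 0, 0] : Fin 8 → Fin 6) a else if (b : ℕ) = a + 1 then (![0, 0, 1, 1, 2, 3, 4, 0] : Fin 8 → Fin 6) a else if (a : ℕ) = b + 1 then (![0, 0, 1, 1, 2, 3, 4, 0] : Fin 8 → Fin 6) b else 0)) ((Equiv.swap (2 : Fin 8) 3 * Equiv.swap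 (4 : Fin 8) 5 * Equiv.swap (6 : Fin 8) 7 : Equiv.Perm (Fin 8)) i) i) : Equiv.Perm (Fin 8) × (Fin 8 → Fin 6))).2 i) : ℤ) :=
          mul_le_mul_of_nonneg_left (hsmax q hq') (by linarith)
        linarith
      · have hθ : θ = -2 ∨ θ = -1 ∨ θ = 0 ∨ θ = 1 ∨ θ = 2 := by omega
        rcases hθ with rfl | rfl | rfl | rfl | rfl
        · exact absurd hp (htie2m p)
        · exact Or.inr (Or.inl ⟨rfl, eq_of_isDominant _ _ _ hp hm1⟩)
        · exact absurd hp (htie0 p)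
        · exact Or.inr (Or.inr (Or.inl ⟨rfl, eq_of_isDominant _ _ _ hp h1⟩))
        · exact absurd hp (htie2p p)
    · rintro (⟨h, rfl⟩ | ⟨rfl, rfl⟩ | ⟨rfl, rfl⟩ | ⟨h, rfl⟩)
      · -- transport `{0}` down from `−3`
        refine ⟨h3m.1, fun q hq hq' => ?_⟩
        have e1 := h3m.2 q hq hq'
        rw [tropWeight_affine θ (-3) q, tropWeight_affine θ (-3)]
        have e3 : (-3 - θ) * ∑ i, ((![0, 1, 5, 6, 40, 59] : Fin 6 → ℕ) (((((Equiv.swap (0 : Fin 8) 1 : Equiv.Perm (Fin 8)), fun i => (fun a b : Fin 8 => (if (b : ℕ) = a then (![5, 1, 0, 1, 0, 0, 0, 0] : Fin 8 → Fin 6) a else if (b : ℕ) = a + 1 then (![0, 0, 1, 1, 2, 3, 4, 0] : Fin 8 → Fin 6) a else if (a : ℕ) = b + 1 then (![0, 0, 1, 1, 2, 3, 4, 0] : Fin 8 → Fin 6) b else 0)) ((Equiv.swap (0 : Fin 8) 1 : Equiv.Perm (Fin 8)) i) i) : Equiv.Perm (Fin 8) × (Fin 8 → Fin 6))).2 i)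 : ℤ) ≤ (-3 - θ) * ∑ i, ((![0, 1, 5, 6, 40, 59] : Fin 6 → ℕ) (q.2 i) : ℤ) :=
          mul_le_mul_of_nonneg_left (hsmin q hq') (by linarith)
        linarith
      · exact hm1
      · exact h1
      · refine ⟨h3p.1, fun q hq hq' => ?_⟩
        have e1 := h3p.2 q hq hq'
        rw [tropWeight_affine θ 3 q, tropWeight_affine θ 3]
        have e3 : (θ - 3) * ∑ i, ((![0, 1, 5, 6, 40, 59] : Fin 6 → ℕ) (q.2 i) : ℤ) ≤ (θ - 3) * ∑ i, ((![0, 1, 5, 6, 40, 59] : Fin 6 → ℕ) (((((Equiv.swap (2 : Fin 8) 3 * Equiv.swap (4 : Fin 8) 5 * Equiv.swap (6 : Fin 8) 7 : Equiv.Perm (Fin 8)), fun i => (fun a b : Fin 8 => (if (b : ℕ) = a then (![5, 1, 0, 1, 0, 0, 0, 0] : Fin 8 → Fin 6) a else if (b : ℕ) = a + 1 then (![0, 0, 1, 1, 2, 3, 4, 0] : Fin 8 → Fin 6) a else if (a : ℕ) = b + 1 then (![0, 0, 1, 1, 2, 3, 4, 0] : Fin 8 → Fin 6) b else 0)) ((Equiv.swap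 (2 : Fin 8) 3 * Equiv.swap (4 : Fin 8) 5 * Equiv.swap (6 : Fin 8) 7 : Equiv.Perm (Fin 8)) i) i) : Equiv.Perm (Fin 8) × (Fin 8 → Fin 6))).2 i) : ℤ) :=
          mul_le_mul_of_nonneg_left (hsmax q hq') (by linarith)
        linarith
  -- (e) signs
  have s3m : termSign (fun (a b : Fin 8) (l : Fin 6) => (if (((b : ℕ) = a ∨ (b : ℕ) = a + 1 ∨ (a : ℕ) = b + 1) ∧ l = (fun a b : Fin 8 => (if (b : ℕ) = a then (![5, 1, 0, 1, 0, 0, 0, 0] : Fin 8 → Fin 6) a else if (b : ℕ) = a + 1 then (![0, 0, 1, 1, 2, 3, 4, 0] : Fin 8 → Fin 6) a else if (a : ℕ) = b + 1 then (![0, 0, 1, 1, 2, 3, 4, 0] : Fin 8 → Fin 6) b else 0)) a b) then (1 : ℤ) else 0)) (((Equiv.swap (0 : Fin 8) 1 : Equiv.Perm (Fin 8)), fun i => (fun a b : Fin 8 => (if (b : ℕ) = a then (![5, 1, 0, 1, 0, 0, 0, 0] : Fin 8 → Fin 6) a else if (b : ℕ) = a + 1 then (![0, 0, 1, 1, 2,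 3, 4, 0] : Fin 8 → Fin 6) a else if (a : ℕ) = b + 1 then (![0, 0, 1, 1, 2, 3, 4, 0] : Fin 8 → Fin 6) b else 0)) ((Equiv.swap (0 : Fin 8) 1 : Equiv.Perm (Fin 8)) i) i) : Equiv.Perm (Fin 8) × (Fin 8 → Fin 6)) = -1 := by decide +kernel
  have sm1 : termSign (fun (a b : Fin 8) (l : Fin 6) => (if (((b : ℕ) = a ∨ (b : ℕ) = a + 1 ∨ (a : ℕ) = b + 1) ∧ l = (fun a b : Fin 8 => (if (b : ℕ) = a then (![5, 1, 0, 1, 0, 0, 0, 0] : Fin 8 → Fin 6) a else if (b : ℕ) = a + 1 then (![0, 0, 1, 1, 2, 3, 4, 0] : Fin 8 → Fin 6) a else if (a : ℕ) = b + 1 then (![0, 0, 1, 1, 2, 3, 4, 0] : Fin 8 → Fin 6) b else 0)) a b) then (1 : ℤ) else 0)) (((Equiv.swap (1 : Fin 8) 2 * Equiv.swap (3 : Fin 8) 4 : Equiv.Perm (Fin 8)), fun i => (fun a b : Fin 8 => (if (b : ℕ) = a then (![5, 1, 0, 1, 0, 0, 0, 0] : Fin 8 → Fin 6) a else if (b :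 ℕ) = a + 1 then (![0, 0, 1, 1, 2, 3, 4, 0] : Fin 8 → Fin 6) a else if (a : ℕ) = b + 1 then (![0, 0, 1, 1, 2, 3, 4, 0] : Fin 8 → Fin 6) b else 0)) ((Equiv.swap (1 : Fin 8) 2 * Equiv.swap (3 : Fin 8) 4 : Equiv.Perm (Fin 8)) i) i) : Equiv.Perm (Fin 8) × (Fin 8 → Fin 6)) = 1 := by decide +kernel
  have s1 : termSign (fun (a b : Fin 8) (l : Fin 6) => (if (((b : ℕ) = a ∨ (b : ℕ) = a + 1 ∨ (a : ℕ) = b + 1) ∧ l = (fun a b : Fin 8 => (if (b : ℕ) = a then (![5, 1, 0, 1, 0, 0, 0, 0] : Fin 8 → Fin 6) a else if (b : ℕ) = a + 1 then (![0, 0, 1, 1, 2, 3, 4, 0] : Fin 8 → Fin 6) a else if (a : ℕ) = b + 1 then (![0, 0, 1, 1, 2, 3, 4, 0] : Fin 8 → Fin 6) b else 0)) a b) then (1 : ℤ) else 0)) (((Equiv.swap (4 : Fin 8) 5 * Equiv.swap (6 : Fin 8) 7 : Equiv.Perm (Fin 8)), fun i => (fun a b : Fin 8 => (if (b : ℕ)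 = a then (![5, 1, 0, 1, 0, 0, 0, 0] : Fin 8 → Fin 6) a else if (b : ℕ) = a + 1 then (![0, 0, 1, 1, 2, 3, 4, 0] : Fin 8 → Fin 6) a else if (a : ℕ) = b + 1 then (![0, 0, 1, 1, 2, 3, 4, 0] : Fin 8 → Fin 6) b else 0)) ((Equiv.swap (4 : Fin 8) 5 * Equiv.swap (6 : Fin 8) 7 : Equiv.Perm (Fin 8)) i) i) : Equiv.Perm (Fin 8) × (Fin 8 → Fin 6)) = 1 := by decide +kernel
  have s3p : termSign (fun (a b : Fin 8) (l : Fin 6) => (if (((b : ℕ) = a ∨ (b : ℕ) = a + 1 ∨ (a : ℕ) = b + 1) ∧ l = (fun a b : Fin 8 => (if (b : ℕ) = a then (![5, 1, 0, 1, 0, 0, 0, 0] : Fin 8 → Fin 6) a else if (b : ℕ) = a + 1 then (![0, 0, 1, 1, 2, 3, 4, 0] : Fin 8 → Fin 6) a else if (a : ℕ) = b + 1 then (![0, 0, 1, 1, 2, 3, 4, 0] : Fin 8 → Fin 6) b else 0)) a b) then (1 : ℤ) else 0)) (((Equiv.swap (2 : Fin 8) 3 * Equiv.swap (4 : Fin 8)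 5 * Equiv.swap (6 : Fin 8) 7 : Equiv.Perm (Fin 8)), fun i => (fun a b : Fin 8 => (if (b : ℕ) = a then (![5, 1, 0, 1, 0, 0, 0, 0] : Fin 8 → Fin 6) a else if (b : ℕ) = a + 1 then (![0, 0, 1, 1, 2, 3, 4, 0] : Fin 8 → Fin 6) a else if (a : ℕ) = b + 1 then (![0, 0, 1, 1, 2, 3, 4, 0] : Fin 8 → Fin 6) b else 0)) ((Equiv.swap (2 : Fin 8) 3 * Equiv.swap (4 : Fin 8) 5 * Equiv.swap (6 : Fin 8) 7 : Equiv.Perm (Fin 8)) i) i) : Equiv.Perm (Fin 8) × (Fin 8 → Fin 6)) = -1 := by decide +kernel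
  have hsign : ∀ (θ : ℤ) (p : Equiv.Perm (Fin 8) × (Fin 8 → Fin 6)), IsDominant (![0, 1, 5, 6, 40, 59] : Fin 6 → ℕ) (fun (a b : Fin 8) (_ : Fin 6) => -((fun a b : Fin 8 => (if (b : ℕ) = a then (![120, 0, 2, 0, 0, 0, 1, 1] : Fin 8 → ℤ) a else if (b : ℕ) = a + 1 then (![0, 1, 0, 1, 0, 3, 6, 0] : Fin 8 → ℤ) a else if (a : ℕ) = b + 1 then (![0, 1, 0, 1, 0, 3, 6, 0] : Fin 8 → ℤ) b else 0)) a b)) (fun (a b : Fin 8) (l : Fin 6) => (if (((b : ℕ) = a ∨ (b : ℕ) = a + 1 ∨ (a : ℕ) = b + 1) ∧ l = (fun a b : Fin 8 => (if (b : ℕ) = a then (![5, 1, 0, 1, 0, 0, 0, 0] : Fin 8 → Fin 6) a else if (b : ℕ) = a + 1 then (![0, 0, 1, 1, 2, 3, 4, 0] : Fin 8 → Fin 6) a else if (a : ℕ) = b + 1 then (![0, 0, 1, 1, 2, 3, 4, 0] : Fin 8 → Fin 6) b else 0)) a b) then (1 : ℤ) else 0)) θ p → termSign (fun (a b : Fin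 8) (l : Fin 6) => (if (((b : ℕ) = a ∨ (b : ℕ) = a + 1 ∨ (a : ℕ) = b + 1) ∧ l = (fun a b : Fin 8 => (if (b : ℕ) = a then (![5, 1, 0, 1, 0, 0, 0, 0] : Fin 8 → Fin 6) a else if (b : ℕ) = a + 1 then (![0, 0, 1, 1, 2, 3, 4, 0] : Fin 8 → Fin 6) a else if (a : ℕ) = b + 1 then (![0, 0, 1, 1, 2, 3, 4, 0] : Fin 8 → Fin 6) b else 0)) a b) then (1 : ℤ) else 0)) p = if (θ = -1 ∨ θ = 1) then 1 else -1 := by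
    intro θ p hp
    rcases (hclass θ p).1 hp with ⟨h, rfl⟩ | ⟨rfl, rfl⟩ | ⟨rfl, rfl⟩ | ⟨h, rfl⟩
    · rw [s3m, if_neg (by omega)]
    · rw [sm1, if_pos (Or.inl rfl)]
    · rw [s1, if_pos (Or.inr rfl)]
    · rw [s3p, if_neg (by omega)]
  -- (f) the pencil identity (entry by entry)
  have hpencil : (∑ l, (X : ℝ[X]) ^ (![0, 1, 5, 6, 40, 59] : Fin 6 → ℕ) l • (patchMatrix 2 (fun (a b : Fin 8) (_ : Fin 6) => -((fun a b : Fin 8 => (if (b : ℕ) = a then (![120, 0, 2, 0, 0, 0, 1, 1] : Fin 8 → ℤ) a else if (b : ℕ) = a + 1 then (![0, 1, 0, 1, 0, 3, 6, 0] : Fin 8 → ℤ) a else if (a : ℕ) = b + 1 then (![0, 1, 0, 1, 0, 3, 6, 0] : Fin 8 → ℤ) b else 0)) a b)) (fun (a b : Fin 8) (l : Fin 6) => (if (((b : ℕ) = a ∨ (b : ℕ) = a + 1 ∨ (a : ℕ) = b + 1) ∧ l = (fun a b : Fin 8 => (if (b : ℕ) = a then (![5, 1, 0, 1, 0, 0,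 0, 0] : Fin 8 → Fin 6) a else if (b : ℕ) = a + 1 then (![0, 0, 1, 1, 2, 3, 4, 0] : Fin 8 → Fin 6) a else if (a : ℕ) = b + 1 then (![0, 0, 1, 1, 2, 3, 4, 0] : Fin 8 → Fin 6) b else 0)) a b) then (1 : ℤ) else 0)) l).map C) =
      (ctPath
        (fun t : ℕ => if t = 0 then (C (1329227995784915872903807060280344576 : ℝ) * X ^ 59 : ℝ[X]) else if t = 1 then (X : ℝ[X]) else if t = 2 then (C (4 : ℝ) : ℝ[X]) else if t = 3 then (X : ℝ[X]) else if t = 4 then (1 : ℝ[X]) else if t = 5 then (1 : ℝ[X]) else if t = 6 then (C (2 : ℝ) : ℝ[X]) else if t = 7 then (C (2 : ℝ) : ℝ[X]) else (0 : ℝ[X]))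
        (fun t : ℕ => if t = 0 then (1 : ℝ[X]) else if t = 1 then (C (2 : ℝ) : ℝ[X]) else if t = 2 then (X : ℝ[X]) else if t = 3 then (C (2 : ℝ) * X : ℝ[X]) else if t = 4 then (X ^ 5 : ℝ[X]) else if t = 5 then (C (8 : ℝ) * X ^ 6 : ℝ[X]) else if t = 6 then (C (64 : ℝ) * X ^ 40 : ℝ[X]) else (0 : ℝ[X]))
        (fun t : ℕ => if t = 0 then (0 : ℝ[X]) else if t = 1 then (1 : ℝ[X]) else if t = 2 then (C (2 : ℝ) : ℝ[X]) else if t = 3 then (X : ℝ[X]) else if t = 4 then (C (2 : ℝ) * X : ℝ[X]) else if t = 5 then (X ^ 5 : ℝ[X]) else if t = 6 then (C (8 : ℝ) * X ^ 6 : ℝ[X]) else if t = 7 then (C (64 : ℝ) * X ^ 40 : ℝ[X]) else (0 : ℝ[X])) 8) := by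
    refine Matrix.ext fun i j => ?_
    rw [Matrix.sum_apply, ctPath_apply]
    simp only [Matrix.smul_apply, Matrix.map_apply, patchMatrix, smul_eq_mul, neg_neg]
    fin_cases i <;> fin_cases j <;> simp [Fin.sum_univ_succ] <;> norm_num
  refine ⟨?_, ?_, hclass, hsign, ?_, ?_, hpencil, ?_⟩
  · -- |ε| ≤ 1
    intro i j l
    dsimp only
    split_ifs <;> simp
  · -- symmetric letters
    have hε : ∀ (l' : Fin 6) (a b : Fin 8), (fun (a b : Fin 8) (l : Fin 6) => (if (((b : ℕ) = a ∨ (b : ℕ) = a + 1 ∨ (a : ℕ) = b + 1) ∧ l = (fun a b : Fin 8 => (if (b : ℕ) = a then (![5, 1, 0, 1, 0, 0, 0, 0] : Fin 8 → Fin 6) a else if (b : ℕ) = a + 1 then (![0, 0, 1, 1, 2, 3, 4, 0] : Fin 8 → Fin 6) a else if (a : ℕ) = b + 1 then (![0, 0, 1, 1, 2, 3, 4, 0] : Fin 8 → Fin 6) b else 0)) a b) then (1 : ℤ) else 0)) a b l' = (fun (a b : Fin 8) (l : Fin 6) => (if (((b : ℕ) = a ∨ (b : ℕ) = a + 1 ∨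 (a : ℕ) = b + 1) ∧ l = (fun a b : Fin 8 => (if (b : ℕ) = a then (![5, 1, 0, 1, 0, 0, 0, 0] : Fin 8 → Fin 6) a else if (b : ℕ) = a + 1 then (![0, 0, 1, 1, 2, 3, 4, 0] : Fin 8 → Fin 6) a else if (a : ℕ) = b + 1 then (![0, 0, 1, 1, 2, 3, 4, 0] : Fin 8 → Fin 6) b else 0)) a b) then (1 : ℤ) else 0)) b a l' := by decide +kernel
    have hv : ∀ (l' : Fin 6) (a b : Fin 8), (fun (a b : Fin 8) (_ : Fin 6) => -((fun a b : Fin 8 => (if (b : ℕ) = a then (![120, 0, 2, 0, 0, 0, 1, 1] : Fin 8 → ℤ) a else if (b : ℕ) = a + 1 then (![0, 1, 0, 1, 0, 3, 6, 0] : Fin 8 → ℤ) a else if (a : ℕ) = b + 1 then (![0, 1, 0, 1, 0, 3, 6, 0] : Fin 8 → ℤ) b else 0)) a b)) a b l' = (fun (a b : Fin 8) (_ : Fin 6) => -((fun a b : Fin 8 => (if (b : ℕ) = a then (![120, 0, 2, 0, 0, 0, 1, 1] : Fin 8 → ℤ) a else if (b : ℕ) = a + 1 then (![0, 1, 0, 1,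 0, 3, 6, 0] : Fin 8 → ℤ) a else if (a : ℕ) = b + 1 then (![0, 1, 0, 1, 0, 3, 6, 0] : Fin 8 → ℤ) b else 0)) a b)) b a l' := by decide +kernel
    beta_reduce at hε hv
    intro l
    exact Matrix.IsSymm.ext fun a b => by rw [patchMatrix, patchMatrix, hε l b a, hv l b a]
  · -- alternating chains have `n ≤ 2`: the sign is `+` exactly at `θ = ±1`, the slopes `0, ±2` carry no dominant term,
    -- and `θ` is strictly increasing along the chain
    intro n θ p hθ hdom halt
    by_contra hn
    have hn3 : 3 ≤ n := by omega
    have hS : ∀ (t : ℤ) (q : Equiv.Perm (Fin 8) × (Fin 8 → Fin 6)), IsDominant (![0, 1, 5, 6, 40, 59] : Fin 6 → ℕ) (fun (a b : Fin 8) (_ : Fin 6) => -((fun a b : Fin 8 => (if (b : ℕ) = a then (![120, 0, 2, 0, 0, 0, 1, 1] : Fin 8 → ℤ) a else if (b : ℕ) = a + 1 then (![0, 1, 0, 1, 0, 3, 6, 0] : Fin 8 → ℤ) a else if (a : ℕ) = b + 1 then (![0, 1, 0, 1, 0, 3, 6, 0] : Fin 8 → ℤ) b else 0)) a b)) (fun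 (a b : Fin 8) (l : Fin 6) => (if (((b : ℕ) = a ∨ (b : ℕ) = a + 1 ∨ (a : ℕ) = b + 1) ∧ l = (fun a b : Fin 8 => (if (b : ℕ) = a then (![5, 1, 0, 1, 0, 0, 0, 0] : Fin 8 → Fin 6) a else if (b : ℕ) = a + 1 then (![0, 0, 1, 1, 2, 3, 4, 0] : Fin 8 → Fin 6) a else if (a : ℕ) = b + 1 then (![0, 0, 1, 1, 2, 3, 4, 0] : Fin 8 → Fin 6) b else 0)) a b) then (1 : ℤ) else 0)) t q → t ≤ -3 ∨ t = -1 ∨ t = 1 ∨ 3 ≤ t := by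
      intro t q hq
      rcases (hclass t q).1 hq with ⟨h, -⟩ | ⟨h, -⟩ | ⟨h, -⟩ | ⟨h, -⟩
      · exact Or.inl h
      · exact Or.inr (Or.inl h)
      · exact Or.inr (Or.inr (Or.inl h))
      · exact Or.inr (Or.inr (Or.inr h))
    have a0 := halt ⟨0, by omega⟩
    have a1 := halt ⟨1, by omega⟩
    have a2 := halt ⟨2, by omega⟩
    rw [hsign _ _ (hdom _), hsign _ _ (hdom _)] at a0 a1 a2
    have e1 : (Fin.succ (⟨0, by omega⟩ : Fin n)) = Fin.castSucc (⟨1, by omega⟩ : Fin n) := Fin.ext (by simp)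
    have e2 : (Fin.succ (⟨1, by omega⟩ : Fin n)) = Fin.castSucc (⟨2, by omega⟩ : Fin n) := Fin.ext (by simp)
    rw [e1] at a0
    rw [e2] at a1
    have d1 := hS _ _ (hdom (Fin.castSucc (⟨1, by omega⟩ : Fin n)))
    have d2 := hS _ _ (hdom (Fin.castSucc (⟨2, by omega⟩ : Fin n)))
    have lt1 : θ (Fin.castSucc (⟨0, by omega⟩ : Fin n)) < θ (Fin.castSucc (⟨1, by omega⟩ : Fin n)) :=
      hθ (by simp [Fin.lt_def])
    have lt2 : θ (Fin.castSucc (⟨1, by omega⟩ : Fin n)) < θ (Fin.castSucc (⟨2, by omega⟩ : Fin n)) :=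
      hθ (by simp [Fin.lt_def])
    have lt3 : θ (Fin.castSucc (⟨2, by omega⟩ : Fin n)) < θ (Fin.succ (⟨2, by omega⟩ : Fin n)) :=
      hθ (by simp [Fin.lt_def])
    split_ifs at a0 a1 a2 <;> omega
  · -- a chain with `n = 2`: `{0} @ −3`, `{1,3} @ −1`, `{2,4,6} @ 3`
    refine ⟨![-3, -1, 3], ![(((Equiv.swap (0 : Fin 8) 1 : Equiv.Perm (Fin 8)), fun i => (fun a b : Fin 8 => (if (b : ℕ) = a then (![5, 1, 0, 1, 0, 0, 0, 0] : Fin 8 → Fin 6) a else if (b : ℕ) = a + 1 then (![0, 0, 1, 1, 2, 3, 4, 0] : Fin 8 → Fin 6) a else if (a : ℕ) = b + 1 then (![0, 0, 1, 1, 2, 3, 4, 0] : Fin 8 → Fin 6) b else 0)) ((Equiv.swap (0 : Fin 8) 1 : Equiv.Perm (Fin 8)) i) i) : Equiv.Perm (Fin 8) × (Fin 8 → Fin 6)), (((Equiv.swap (1 : Fin 8) 2 * Equiv.swap (3 : Fin 8) 4 : Equiv.Perm (Fin 8)), fun i => (fun a b : Fin 8 => (if (b : ℕ) = a then (![5, 1,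 0, 1, 0, 0, 0, 0] : Fin 8 → Fin 6) a else if (b : ℕ) = a + 1 then (![0, 0, 1, 1, 2, 3, 4, 0] : Fin 8 → Fin 6) a else if (a : ℕ) = b + 1 then (![0, 0, 1, 1, 2, 3, 4, 0] : Fin 8 → Fin 6) b else 0)) ((Equiv.swap (1 : Fin 8) 2 * Equiv.swap (3 : Fin 8) 4 : Equiv.Perm (Fin 8)) i) i) : Equiv.Perm (Fin 8) × (Fin 8 → Fin 6)), (((Equiv.swap (2 : Fin 8) 3 * Equiv.swap (4 : Fin 8) 5 * Equiv.swap (6 : Fin 8) 7 : Equiv.Perm (Fin 8)), fun i => (fun a b : Fin 8 => (if (b : ℕ) = a then (![5, 1, 0, 1, 0, 0, 0, 0] : Fin 8 → Fin 6) a else if (b : ℕ) = a + 1 then (![0, 0, 1, 1, 2, 3, 4, 0] : Fin 8 → Fin 6) a else if (a : ℕ) = b + 1 then (![0, 0, 1, 1, 2, 3, 4, 0] : Fin 8 → Fin 6) b else 0)) ((Equiv.swap (2 : Fin 8) 3 * Equiv.swap (4 : Fin 8) 5 * Equiv.swap (6 : Fin 8) 7 : Equiv.Perm (Fin 8)) i)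 i) : Equiv.Perm (Fin 8) × (Fin 8 → Fin 6))], ?_, ?_, ?_⟩
    · rw [Fin.strictMono_iff_lt_succ]; decide
    · intro k
      fin_cases k
      · exact h3m
      · exact hm1
      · exact h3p
    · intro k
      fin_cases k
      · simp only [Fin.castSucc_mk, Fin.succ_mk]
        show termSign (fun (a b : Fin 8) (l : Fin 6) => (if (((b : ℕ) = a ∨ (b : ℕ) = a + 1 ∨ (a : ℕ) = b + 1) ∧ l = (fun a b : Fin 8 => (if (b : ℕ) = a then (![5, 1, 0, 1, 0, 0, 0, 0] : Fin 8 → Fin 6) a else if (b : ℕ) = a + 1 then (![0, 0, 1, 1, 2, 3, 4, 0] : Fin 8 → Fin 6) a else if (a : ℕ) = b + 1 then (![0, 0, 1, 1, 2, 3, 4, 0] : Fin 8 → Fin 6) b else 0)) a b) then (1 : ℤ) else 0)) (((Equiv.swap (0 : Fin 8) 1 : Equiv.Perm (Fin 8)), fun i => (fun a b : Fin 8 => (if (b : ℕ) = a then (![5, 1, 0, 1, 0, 0, 0, 0] : Fin 8 → Fin 6) a else if (b : ℕ) = a + 1 then (![0, 0, 1, 1, 2, 3, 4, 0] : Fin 8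 → Fin 6) a else if (a : ℕ) = b + 1 then (![0, 0, 1, 1, 2, 3, 4, 0] : Fin 8 → Fin 6) b else 0)) ((Equiv.swap (0 : Fin 8) 1 : Equiv.Perm (Fin 8)) i) i) : Equiv.Perm (Fin 8) × (Fin 8 → Fin 6)) * termSign (fun (a b : Fin 8) (l : Fin 6) => (if (((b : ℕ) = a ∨ (b : ℕ) = a + 1 ∨ (a : ℕ) = b + 1) ∧ l = (fun a b : Fin 8 => (if (b : ℕ) = a then (![5, 1, 0, 1, 0, 0, 0, 0] : Fin 8 → Fin 6) a else if (b : ℕ) = a + 1 then (![0, 0, 1, 1, 2, 3, 4, 0] : Fin 8 → Fin 6) a else if (a : ℕ) = b + 1 then (![0, 0, 1, 1, 2, 3, 4, 0] : Fin 8 → Fin 6) b else 0)) a b) then (1 : ℤ) else 0)) (((Equiv.swap (1 : Fin 8) 2 * Equiv.swap (3 : Fin 8) 4 : Equiv.Perm (Fin 8)), fun i => (fun a b : Fin 8 => (if (b : ℕ) = a then (![5, 1, 0, 1, 0, 0, 0, 0] : Fin 8 → Fin 6) a else if (b : ℕ) = a + 1 then (![0, 0, 1, 1, 2, 3, 4,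 0] : Fin 8 → Fin 6) a else if (a : ℕ) = b + 1 then (![0, 0, 1, 1, 2, 3, 4, 0] : Fin 8 → Fin 6) b else 0)) ((Equiv.swap (1 : Fin 8) 2 * Equiv.swap (3 : Fin 8) 4 : Equiv.Perm (Fin 8)) i) i) : Equiv.Perm (Fin 8) × (Fin 8 → Fin 6)) < 0
        rw [s3m, sm1]; norm_num
      · show termSign (fun (a b : Fin 8) (l : Fin 6) => (if (((b : ℕ) = a ∨ (b : ℕ) = a + 1 ∨ (a : ℕ) = b + 1) ∧ l = (fun a b : Fin 8 => (if (b : ℕ) = a then (![5, 1, 0, 1, 0, 0, 0, 0] : Fin 8 → Fin 6) a else if (b : ℕ) = a + 1 then (![0, 0, 1, 1, 2, 3, 4, 0] : Fin 8 → Fin 6) a else if (a : ℕ) = b + 1 then (![0, 0, 1, 1, 2, 3, 4, 0] : Fin 8 → Fin 6) b else 0)) a b) then (1 : ℤ) else 0)) (((Equiv.swap (1 : Fin 8) 2 * Equiv.swap (3 : Fin 8) 4 : Equiv.Perm (Fin 8)), fun i => (fun a b : Fin 8 => (if (b : ℕ) = a then (![5, 1, 0, 1, 0, 0, 0, 0]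 : Fin 8 → Fin 6) a else if (b : ℕ) = a + 1 then (![0, 0, 1, 1, 2, 3, 4, 0] : Fin 8 → Fin 6) a else if (a : ℕ) = b + 1 then (![0, 0, 1, 1, 2, 3, 4, 0] : Fin 8 → Fin 6) b else 0)) ((Equiv.swap (1 : Fin 8) 2 * Equiv.swap (3 : Fin 8) 4 : Equiv.Perm (Fin 8)) i) i) : Equiv.Perm (Fin 8) × (Fin 8 → Fin 6)) * termSign (fun (a b : Fin 8) (l : Fin 6) => (if (((b : ℕ) = a ∨ (b : ℕ) = a + 1 ∨ (a : ℕ) = b + 1) ∧ l = (fun a b : Fin 8 => (if (b : ℕ) = a then (![5, 1, 0, 1, 0, 0, 0, 0] : Fin 8 → Fin 6) a else if (b : ℕ) = a + 1 then (![0, 0, 1, 1, 2, 3, 4, 0] : Fin 8 → Fin 6) a else if (a : ℕ) = b + 1 then (![0, 0, 1, 1, 2, 3, 4, 0] : Fin 8 → Fin 6) b else 0)) a b) then (1 : ℤ) else 0)) (((Equiv.swap (2 : Fin 8) 3 * Equiv.swap (4 : Fin 8) 5 * Equiv.swap (6 : Fin 8) 7 : Equiv.Perm (Fin 8)), fun i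 => (fun a b : Fin 8 => (if (b : ℕ) = a then (![5, 1, 0, 1, 0, 0, 0, 0] : Fin 8 → Fin 6) a else if (b : ℕ) = a + 1 then (![0, 0, 1, 1, 2, 3, 4, 0] : Fin 8 → Fin 6) a else if (a : ℕ) = b + 1 then (![0, 0, 1, 1, 2, 3, 4, 0] : Fin 8 → Fin 6) b else 0)) ((Equiv.swap (2 : Fin 8) 3 * Equiv.swap (4 : Fin 8) 5 * Equiv.swap (6 : Fin 8) 7 : Equiv.Perm (Fin 8)) i) i) : Equiv.Perm (Fin 8) × (Fin 8 → Fin 6)) < 0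
        rw [sm1, s3p]; norm_num
  · -- ten positive zeros (p563540)
    rw [hpencil]
    exact StaticTridiagonalRealExcess.ten_le_card_posRoots_eight10

/-- **SUMMARY**: there is a dominance design of format `(8, 6)` (`|ε| ≤ 1`, symmetric patchwork letters) whose sign-alternating dominant chains
along strictly increasing integer slopes have `n ≤ 2` — with `n = 2` attained, so its own tropical census row is EXACTLY `2` — and whose base-2
patchwork, the static definite tridiagonal EightTen design, has at least `10` distinct positive determinant zeros. [this file] -/
theorem boost8_shadow_exists :
    ∃ (d : Fin 6 → ℕ) (v ε : Fin 8 → Fin 8 → Fin 6 → ℤ),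
      (∀ i j l, (ε i j l).natAbs ≤ 1) ∧ (∀ l, (patchMatrix 2 v ε l).IsSymm) ∧
      (∀ (n : ℕ) (θ : Fin (n + 1) → ℤ) (p : Fin (n + 1) → Equiv.Perm (Fin 8) × (Fin 8 → Fin 6)), StrictMono θ →
        (∀ k, IsDominant d v ε (θ k) (p k)) →
        (∀ k : Fin n, termSign ε (p k.castSucc) * termSign ε (p k.succ) < 0) → n ≤ 2) ∧
      (∃ (θ : Fin 3 → ℤ) (p : Fin 3 → Equiv.Perm (Fin 8) × (Fin 8 → Fin 6)), StrictMono θ ∧ (∀ k, IsDominant d v ε (θ k) (p k)) ∧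
        (∀ k : Fin 2, termSign ε (p k.castSucc) * termSign ε (p k.succ) < 0)) ∧
      10 ≤ ((∑ l, (X : ℝ[X]) ^ d l • (patchMatrix 2 v ε l).map C).det.roots.toFinset.filter (fun t => 0 < t)).card := by
  obtain ⟨h1, h2, -, -, h5, h6, -, h8⟩ := boost8_shadow
  exact ⟨_, _, _, h1, h2, h5, h6, h8⟩

end Summit.ValiantsHypothesis.ValiantsHypothesis.Theorems.KPlusLogSqLaw.StaticTridiagonalRealBoostEightShadow
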